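import Mathlib
import HarnessLib
import Literature.MathematicalPhysics.StatisticalMechanics.RenormalisationMapRemainderOneFinal
import Literature.MathematicalPhysics.StatisticalMechanics.RenormalisationMapDecompositionABKM
import Literature.MathematicalPhysics.StatisticalMechanics.RenormalisationMapBlockTermsQ
import Literature.MathematicalPhysics.StatisticalMechanics.RenormalisationMapP2FluctQ
import Literature.MathematicalPhysics.StatisticalMechanics.LinearisedMapABKMContractionQ

/-!
# The decomposition of `S_k^{(q)}` and the block sum `Σ₁` for step data with a kernel BY PREDICATE
# ([ABKM19] Theorem 6.8 (6.59)–(6.60), `q ∈ B_κ`)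

The remainder sums of the decomposition `S_k(H,K)(U) = blockPart + Σ₁ + Σ₂ᴸ + Σ₃ + Σ₄` of [ABKM19]
(6.59)–(6.60) were bounded in the tree for the step kernel EQUAL to the weight kernel `𝒞_{k+1}`
(`q = 0`).  Of the kernel the proofs use only the facts recorded in `StepKernelBounds`
(`StepKernelBoundsABKM`) and the shift bound via `C₂ ≤ h²`.  This file is the `q`-twin for step
data / kernels with `StepKernelBounds W L k A𝒫' C₂ ·` relative to the `q = 0` weights
(constant `A_𝒫 ↦ A𝒫'`; `C₂ ≤ h²` in place of the regularity-constant hypothesis):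

* `nextKStep_eq_blockPart_add_remainders_abkm_of_stepKernelBounds`;
* **`tayNormLE_remainderOne_sub_abkm_of_stepKernelBounds`**, **`tayNormLE_remainderOne_sub_abkm_final_of_stepKernelBounds`**.

The `q = 0` statements are recovered with `AbkmWeightBounds.stepKernelBounds`.  Everything is proved;
no named fact.

## References
* S. Adams, S. Buchholz, R. Kotecký, S. Müller, arXiv:1910.13564, Theorem 6.8 ((6.59)–(6.60)), Ch. 9.1,
  Lemmas 10.1–10.6, Lemma 7.7 [AdamsBuchholzKoteckyMuller2019].
-/

noncomputable section

namespace Literature.MathematicalPhysics.StatisticalMechanics.GradientRG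

open scoped BigOperators Classical
open Finset Matrix MeasureTheory
open Literature.MathematicalPhysics.StatisticalMechanics.TorusPolymer
  (IsPolymer blocks polys bprod blockOf thicken reblock boxCorner mem_polys mem_blocks numBlocks isPolymer_blockOf
    card_blocks_eq_numBlocks blocks_blockOf empty_mem_polys reblock_empty subset_thicken sum_large_regroup
    bprod_empty blocks_empty blocks_mono add_pow_sub_pow_le sum_rest_blockOf_eq_zero closure)
open Literature.Barriers.CriticalPhenomena.LongRangePhi4.Polymer (IsConn components)
open Literature.MathematicalPhysics.StatisticalMechanics.GradientFRD (iterDiff)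
open Literature.MathematicalPhysics.QuantumFieldTheory

variable {d M : ℕ} [NeZero M]

/-- **`S(H,K)(U) = blockPart(C_kK)(U) + Σ₁ + Σ₂ᴸ + Σ₃ + Σ₄` for the torus data** (module docstring):
`d ≥ 2`, `L` odd, `L ≥ 2^{d+3}+16R`, `M = L^N`, `k+1 ≤ N`, `p ≤ R`, `⌊d/2⌋+1 ≤ min(p, M_ord)`,
`θ̄, λ, δ₀, δ₁ > 0`, `h² ≥ h₀²`, `A > 0`; `‖H‖_{k,0} ≤ 1/8`; `U ≠ ∅`.
[cite: AdamsBuchholzKoteckyMuller2019, Theorem 6.8 / Ch. 9.1 / Ch. 10.1 (10.1)–(10.3)] -/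
theorem nextKStep_eq_blockPart_add_remainders_abkm_of_stepKernelBounds {L N Mord R n p r₀ : ℕ} {θbar lam μ δ₁ δ₀ A𝒫 A𝒫' C₂ h A : ℝ}
    {𝒞 : ℕ → (Fin d → ZMod M) → ℝ} (hd : 2 ≤ d) (hLodd : Odd L) (hL : 2 ^ (d + 3) + 16 * R ≤ L)
    (hM : M = L ^ N) {k : ℕ} (hkN : k + 1 ≤ N) (hp : d / 2 + 1 ≤ p) (hpR : p ≤ R) (hMord : d / 2 + 1 ≤ Mord)
   
    (hB : AbkmWeightBounds L N Mord R n θbar lam μ δ₁ δ₀ A𝒫 𝒞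
      (abkmWeightData L N Mord R θbar (schedDelta δ₀ δ₁ N) 𝒞))
    (hδ₀ : 0 < δ₀) (hδ₁ : 0 < δ₁) (hh : 0 < h) (hh0 : hZeroSq d R δ₀ δ₁ ≤ h ^ 2) (hA : 0 < A)
    (D : StepData d M) (hDs : D.s = L ^ k) (hDL : D.L = L) (hS : StepKernelBounds (abkmWeightData L N Mord R θbar (schedDelta δ₀ δ₁ N) 𝒞) L k A𝒫' C₂ D.𝒞)
    {x₀ : Fin d → ZMod M} (hB₀ : D.B₀ = blockOf (L ^ k) x₀) (hc₀ : D.c₀ = boxCorner (L ^ k) (starRad R L d k) x₀)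
    {H : RelevantHamiltonian ℂ d}
    (hH : hamNorm (fieldWt h (L : ℝ) d k) ((L : ℝ) ^ k) (L ^ (d * k)) H ≤ 1 / 8)
    {K : Finset (Fin d → ZMod M) → ((Fin d → ZMod M) → ℝ) → ℂ} {C : ℝ} (hC : 0 ≤ C)
    (hK : WeakNormLE (abkmNormParams L N Mord R p r₀ h θbar A (schedDelta δ₀ δ₁ N) 𝒞) k K C)
    (hKfac : Factorises (L ^ k) K) (hK0 : ∀ φ, K ∅ φ = 1) (hKd : ∀ Y, ContDiff ℝ r₀ (K Y))
    (hKloc : ∀ Y, IsPolymer (L ^ k) Y → IsConn Y →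
      IsGaugeLocal ((abkmNormParams L N Mord R p r₀ h θbar A (schedDelta δ₀ δ₁ N) 𝒞).gauge k Y) (K Y))
    {U : Finset (Fin d → ZMod M)} (hUne : U.Nonempty) (φ : (Fin d → ZMod M) → ℝ) :
    nextKStep D H K U φ =
      blockPart D K U φ +
      (∑ B ∈ blockPartIndex D U,
        ((bprod (L ^ k) (fun B' => expNegH (nextH D H K) B' φ) (U \ B) *
              bprod (L ^ k) (fun B' => expNegH (-(nextH D H K)) B' φ) (B \ U) - 1) * blockTerm D K B φ +
          bprod (L ^ k) (fun B' => expNegH (nextH D H K) B' φ) (U \ B) *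
              bprod (L ^ k) (fun B' => expNegH (-(nextH D H K)) B' φ) (B \ U) *
            (fluctDefect D.𝒞 H B φ +
              (expNegH (stepOpA (gradCov D.𝒞) H) B φ - 1) * (1 - Complex.exp (-(eval (opB D K) B φ))) -
              (Complex.exp (-(eval (opB D K) B φ)) - 1 + eval (opB D K) B φ)) +
          bprod (L ^ k) (fun B' => expNegH (nextH D H K) B' φ) (U \ B) *
              bprod (L ^ k) (fun B' => expNegH (-(nextH D H K)) B' φ) (B \ U) *
            fluct D.𝒞 (fun ψ => ∑ Y ∈ ((polys (L ^ k) B).erase B).erase ∅,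
              bprod (L ^ k) (fun B' => expNegH H B' ψ - 1) (B \ Y) * K Y ψ) φ)) +
      (∑ X ∈ largePartIndex (L ^ k) L U,
        bprod (L ^ k) (fun B => expNegH (nextH D H K) B φ) (U \ X) *
            bprod (L ^ k) (fun B => expNegH (-(nextH D H K)) B φ) (X \ U) *
          (fluct D.𝒞 (polyP2 (L ^ k) H K X) φ + bprod (L ^ k) (fun B => 1 - expNegH (nextH D H K) B φ) X)) +
      (∑ X ∈ ((polys (L ^ k) univ).filter (fun X => reblock (L ^ k) (L * L ^ k) X = U)).filter
          (fun X => ¬ IsConn X),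
        bprod (L ^ k) (fun B => expNegH (nextH D H K) B φ) (U \ X) *
            bprod (L ^ k) (fun B => expNegH (-(nextH D H K)) B φ) (X \ U) *
          (fluct D.𝒞 (polyP2 (L ^ k) H K X) φ + bprod (L ^ k) (fun B => 1 - expNegH (nextH D H K) B φ) X)) +
      ∑ X ∈ (polys (L ^ k) univ).filter (fun X => reblock (L ^ k) (L * L ^ k) X = U),
        ∑ X₁ ∈ ((polys (L ^ k) X).erase X).erase ∅,
          bprod (L ^ k) (fun B => expNegH (nextH D H K) B φ) (U \ X) *
            bprod (L ^ k) (fun B => expNegH (-(nextH D H K)) B φ) (X \ U) *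
            (bprod (L ^ k) (fun B => 1 - expNegH (nextH D H K) B φ) X₁ *
              fluct D.𝒞 (polyP2 (L ^ k) H K (X \ X₁)) φ) := by
  set P := abkmNormParams L N Mord R p r₀ h θbar A (schedDelta δ₀ δ₁ N) 𝒞 with hP
  set W := abkmWeightData L N Mord R θbar (schedDelta δ₀ δ₁ N) 𝒞 with hW
  have hL0 : (0 : ℝ) < L := by exact_mod_cast hLodd.pos
  have hk1 : k + 1 ≤ N + 1 := by omega
  have hk : k ≤ N := by omega
  have hMo : Odd M := by rw [hM]; exact hLodd.pow
  have hsodd : Odd (L ^ k) := hLodd.pow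
  obtain ⟨t, ht⟩ : ∃ t, N = k + t := ⟨N - k, by omega⟩
  have hMt : M = L ^ k * L ^ t := by rw [← pow_add, ← ht]; exact hM
  have htodd : Odd (L ^ t) := hLodd.pow
  have h𝔥 : 0 < fieldWt h (L : ℝ) d k := fieldWt_pos hh hL0 d k
  have hRk : (0 : ℝ) < (L : ℝ) ^ k := by positivity
  -- the step data is the concrete one: substitute its fields
  obtain ⟨s, L', 𝒸, c₀, B₀⟩ := D
  simp only at hDs hDL hS hB₀ hc₀
  subst s L' c₀ B₀
  -- the hypotheses of `nextKStep_sub_opC_eq`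
  have hC𝒞 : (Matrix.circulant 𝒸).PosSemidef := hS.posSemidef
  have hBne : (blockOf (L ^ k) x₀ : Finset (Fin d → ZMod M)).card ≠ 0 :=
    (card_pos.2 ⟨x₀, TorusPolymer.mem_blockOf_self _ x₀⟩).ne'
  obtain ⟨hwrap0, hroom0⟩ := abkm_box_lt (d := d) hL hpR hkN
  have hwrap : 4 * ((L ^ k - 1) / 2 + starRad R L d k) < M := by rw [hM]; exact hwrap0
  have hroomB : ∀ x ∈ blockOf (L ^ k) x₀, HasRoom (boxCorner (L ^ k) (starRad R L d k) x₀) x (d / 2 + 1) := by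
    intro x hx
    have hxS : x ∈ thicken (starRad R L d k) (blockOf (L ^ k) x₀) := subset_thicken _ _ hx
    have hin := (TorusPolymer.mem_thicken_blockOf_iff_inBox hMt hLodd.pow htodd hwrap x₀ x).1 hxS
    refine TorusPolymer.hasRoom_of_inBox hin ?_
    have h2 : ((2 * ((L ^ k - 1) / 2 + starRad R L d k) : ℕ) + ((d / 2 + 1 : ℕ) : ℤ)) * 2 < (M : ℤ) := by
      have : (2 * ((L ^ k - 1) / 2 + starRad R L d k) + (d / 2 + 1)) * 2 < M := by
        rw [hM]; have := hroom0; omega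
      exact_mod_cast this
    exact_mod_cast h2
  -- integrability of `P₂(Z, φ + ·)`
  have hint : ∀ Z, IsPolymer (L ^ k) Z →
      Integrable (fun ξ => polyP2 (L ^ k) H K Z (φ + ξ)) (stepMeasure 𝒸) := by
    intro Z hZ
    have hb := tayNormLE_polyP2_abkm (p := p) (r₀ := r₀) hd hLodd hM hkN hp hMord hB hδ₀ hδ₁ hh hh0 hA hZ hH hC hK
      hKfac hK0 hKd hKloc
    have hc : 0 ≤ ∑ Y ∈ polys (L ^ k) Z, (∏ _B ∈ blocks (L ^ k) (Z \ Y),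
        8 * Real.exp (1 / 4) * hamNorm (fieldWt h (L : ℝ) d k) ((L : ℝ) ^ k) (L ^ (d * k)) H) *
        ∏ Z' ∈ components Y, C * P.aFactor k Z' := by
      refine sum_nonneg fun Y _ => mul_nonneg (prod_nonneg fun _ _ => ?_) (prod_nonneg fun Z' _ => ?_)
      · have := hamNorm_nonneg h𝔥.le hRk.le (L ^ (d * k)) H; positivity
      · exact mul_nonneg hC (WeakNormLE.aFactor_pos hA k Z').le
    exact integrable_comp_add_of_tayNormLE hb hc (contDiff_polyP2 (L ^ k) H hKd Z)
      (isGaugeLocal_polyP2_abkm (p := p) (r₀ := r₀) (θbar := θbar) (A := A) (δ := schedDelta δ₀ δ₁ N) (𝒞 := 𝒞)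
        (N := N) (Mord := Mord) (R := R) hLodd hM hk hh hp H hKfac hK0 hKloc hZ)
      (hS.weightSectionDominated hB.dominated Z (P.gauge k Z)) φ
  -- the split of `R[P₂(X)]`
  have hsplit : ∀ X ∈ (polys (L ^ k) univ).filter (fun X => reblock (L ^ k) (L * L ^ k) X = U),
      fluct 𝒸 (polyP2 (L ^ k) H K X) φ =
        fluct 𝒸 (K X) φ + fluct 𝒸 (fun ψ => bprod (L ^ k) (fun B => expNegH H B ψ - 1) X) φ +
          fluct 𝒸 (fun ψ => ∑ Y ∈ ((polys (L ^ k) X).erase X).erase ∅,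
            bprod (L ^ k) (fun B => expNegH H B ψ - 1) (X \ Y) * K Y ψ) φ := by
    intro X hX
    obtain ⟨hXp, hXU⟩ := mem_filter.1 hX
    have hXpoly : IsPolymer (L ^ k) X := (mem_polys.1 hXp).2
    have hXne : X.Nonempty := by
      rw [nonempty_iff_ne_empty]
      intro h0
      rw [h0, reblock_empty] at hXU
      exact hUne.ne_empty hXU.symm
    exact fluct_polyP2_eq_add_add_rest_abkm_of_stepKernelBounds hd hLodd hM hkN hS hp hMord hB hδ₀ hδ₁ hh hh0 hA hXpoly hXne hH
      hC hK hKfac hK0 hKd hKloc φ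
  -- integrability of `e^{−H(B, φ+·)}` on blocks
  have hI : ∀ B ∈ blockPartIndex (⟨L ^ k, L, 𝒸, boxCorner (L ^ k) (starRad R L d k) x₀, blockOf (L ^ k) x₀⟩ :
        StepData d M) U,
      Integrable (fun ξ => expNegH H B (φ + ξ)) (stepMeasure 𝒸) := by
    intro B hB'
    have hBb := blockPartIndex_subset_blocks _ U hB'
    obtain ⟨y, -, rfl⟩ := mem_blocks.1 hBb
    have hBS : blockOf (L ^ k) y ⊆ thicken (P.rad k) (blockOf (L ^ k) y) := subset_thicken _ _
    have hcard : (blockOf (L ^ k) y).card = L ^ (d * k) := by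
      rw [TorusPolymer.card_blockOf hMt hLodd.pow htodd y, ← pow_mul, mul_comm]
    have hHB : hamNorm (fieldWt h (L : ℝ) d k) ((L : ℝ) ^ k) (blockOf (L ^ k) y).card H ≤ 1 / 8 := by
      rw [hcard]; exact hH
    have hs := tayNormLE_expNegH_strong_abkm (R := R) (Mord := Mord) hd hLodd hM hk hh hMord hp hBS r₀ hHB
    have hgauge : P.gauge k (blockOf (L ^ k) y) =
        fieldGauge (fieldWt h (L : ℝ) d k) ((L : ℝ) ^ k) p (thicken (P.rad k) (blockOf (L ^ k) y)) := rfl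
    rw [← hgauge] at hs
    have hSW : ∀ ψ, expWeight (strongCoef h N k • derivForm (L : ℝ) k (diffIndex d Mord)
        (boxDensity (boxRad R L k) (boxWt (L : ℝ) d k) (blockOf (L ^ k) y))) ψ ≤ W.weight k (blockOf (L ^ k) y) ψ :=
      fun ψ => strongWeight_le_weight_abkm hB hδ₀ hδ₁ hh hh0 k (subset_refl _) ψ
    have hev : IsGaugeLocal (P.gauge k (blockOf (L ^ k) y)) (fun φ : (Fin d → ZMod M) → ℝ => eval H (blockOf (L ^ k) y) φ) := by
      rw [hgauge]; exact isGaugeLocal_eval h𝔥.ne' hRk.ne' hp hBS H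
    have hexp_loc : IsGaugeLocal (P.gauge k (blockOf (L ^ k) y)) (expNegH H (blockOf (L ^ k) y)) :=
      fun φ ψ hT => by simp only [expNegH, hev φ ψ hT]
    have hexp_d : ContDiff ℝ r₀ (expNegH H (blockOf (L ^ k) y)) := by
      show ContDiff ℝ r₀ (fun φ : (Fin d → ZMod M) → ℝ => Complex.exp (-(eval H (blockOf (L ^ k) y) φ)))
      exact (contDiff_eval H _ (n := r₀)).neg.cexp
    exact integrable_comp_add_of_tayNormLE (hs.mono_weight (Real.exp_pos _).le hSW) (Real.exp_pos _).le hexp_d hexp_loc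
      (hS.weightSectionDominated hB.dominated _ (P.gauge k _)) φ
  -- the identity of RenormalisationMapRemainder and the regrouping of the second sum
  have hmain := nextKStep_sub_opC_eq ⟨L ^ k, L, 𝒸, boxCorner (L ^ k) (starRad R L d k) x₀, blockOf (L ^ k) x₀⟩
    hMo hsodd hLodd hC𝒞 hBne hroomB H K hK0 hUne φ hint hsplit hI
  simp only at hmain
  have hlarge : ∀ X ∈ largePartIndex (L ^ k) L U,
      fluct 𝒸 (polyP2 (L ^ k) H K X) φ =
        fluct 𝒸 (K X) φ + fluct 𝒸 (fun ψ => bprod (L ^ k) (fun B => expNegH H B ψ - 1) X) φ +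
          fluct 𝒸 (fun ψ => ∑ Y ∈ ((polys (L ^ k) X).erase X).erase ∅,
            bprod (L ^ k) (fun B => expNegH H B ψ - 1) (X \ Y) * K Y ψ) φ := by
    intro X hX
    obtain ⟨hXp, -, -, hXU⟩ := mem_largePartIndex.1 hX
    exact hsplit X (mem_filter.2 ⟨mem_polys.2 ⟨subset_univ _, hXp⟩, hXU⟩)
  have hreg := sum_large_regroup (largePartIndex (L ^ k) L U)
    (fun X => bprod (L ^ k) (fun B => expNegH (nextH ⟨L ^ k, L, 𝒸, boxCorner (L ^ k) (starRad R L d k) x₀,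
        blockOf (L ^ k) x₀⟩ H K) B φ) (U \ X) *
      bprod (L ^ k) (fun B => expNegH (-(nextH ⟨L ^ k, L, 𝒸, boxCorner (L ^ k) (starRad R L d k) x₀,
        blockOf (L ^ k) x₀⟩ H K)) B φ) (X \ U))
    (fun X => fluct 𝒸 (K X) φ)
    (fun X => fluct 𝒸 (fun ψ => bprod (L ^ k) (fun B => expNegH H B ψ - 1) X) φ)
    (fun X => fluct 𝒸 (fun ψ => ∑ Y ∈ ((polys (L ^ k) X).erase X).erase ∅,
      bprod (L ^ k) (fun B => expNegH H B ψ - 1) (X \ Y) * K Y ψ) φ)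
    (fun X => bprod (L ^ k) (fun B => 1 - expNegH (nextH ⟨L ^ k, L, 𝒸, boxCorner (L ^ k) (starRad R L d k) x₀,
        blockOf (L ^ k) x₀⟩ H K) B φ) X)
    (fun X => fluct 𝒸 (polyP2 (L ^ k) H K X) φ) hlarge
  rw [hreg] at hmain
  have hopC : opC ⟨L ^ k, L, 𝒸, boxCorner (L ^ k) (starRad R L d k) x₀, blockOf (L ^ k) x₀⟩ K U φ =
      blockPart ⟨L ^ k, L, 𝒸, boxCorner (L ^ k) (starRad R L d k) x₀, blockOf (L ^ k) x₀⟩ K U φ +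
        ∑ X ∈ largePartIndex (L ^ k) L U, fluct 𝒸 (K X) φ := rfl
  rw [hopC] at hmain
  linear_combination hmain
set_option maxHeartbeats 400000 in
/-- **`Σ₁` (the block sum of `nextKStep_sub_opC_eq`) is Lipschitz** (module docstring): torus data at scale
`k` (`d ≥ 3`, `L` odd, `L ≥ 2^{d+3}+16R`, `R ≥ 2`, `M = L^N`, `k+1 ≤ N`, `p ≤ R`, `⌊d/2⌋+1 ≤ min(p, M_ord)`, `r₀ ≥ 2`,
kernel regularity with `h² ≥ secondDiffConst`, `h² ≥ h₀²`, `A ≥ 1`, `A_𝒫 ≥ 0`), step data `D` with `D.s = L^k`,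
`D.L = L`, `D.𝒞 = 𝒞_{k+1}`, reference block `B_{x₀}` and its box corner; `U` a `(k+1)`-polymer; `‖H̃‖,‖H̃'‖ ≤ τ ≤ 1/16`,
`‖H‖,‖H'‖ ≤ b ≤ 1/64`, `‖K‖,‖K'‖ ≤ C`, `‖K−K'‖ ≤ C_Δ`, `C_{8.7}CA_𝒫A^{−1} ≤ 1/64`.
[cite: AdamsBuchholzKoteckyMuller2019, Theorem 6.8 / Lemma 9.6 (proof, first order)] -/
theorem tayNormLE_remainderOne_sub_abkm_of_stepKernelBounds {L N Mord R n p r₀ : ℕ} {θbar lam μ δ₁ δ₀ A𝒫 A𝒫' C₂ h A : ℝ}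
    {𝒞 : ℕ → (Fin d → ZMod M) → ℝ} (hd : 3 ≤ d) (hLodd : Odd L) (hL : 2 ^ (d + 3) + 16 * R ≤ L)
    (hR2 : 2 ≤ R) (hM : M = L ^ N) {k : ℕ} (hkN : k + 1 ≤ N) (hp : d / 2 + 1 ≤ p) (hpR : p ≤ R)
    (hMord : d / 2 + 1 ≤ Mord) (hr₀ : 2 ≤ r₀)
    (hB : AbkmWeightBounds L N Mord R n θbar lam μ δ₁ δ₀ A𝒫 𝒞
      (abkmWeightData L N Mord R θbar (schedDelta δ₀ δ₁ N) 𝒞))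
    (hδ₀ : 0 < δ₀) (hδ₁ : 0 < δ₁) (hh : 0 < h) (hh0 : hZeroSq d R δ₀ δ₁ ≤ h ^ 2)
   
    (hh2 : C₂ ≤ h ^ 2) (hA𝒫 : 0 ≤ A𝒫') (hA1 : 1 ≤ A)
    (D : StepData d M) (hDs : D.s = L ^ k) (hDL : D.L = L) (hS : StepKernelBounds (abkmWeightData L N Mord R θbar (schedDelta δ₀ δ₁ N) 𝒞) L k A𝒫' C₂ D.𝒞)
    {x₀ : Fin d → ZMod M} (hB₀ : D.B₀ = blockOf (L ^ k) x₀) (hc₀ : D.c₀ = boxCorner (L ^ k) (starRad R L d k) x₀)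
    {U : Finset (Fin d → ZMod M)} (hU : IsPolymer (L ^ (k + 1)) U)
    {Ht Ht' H H' : RelevantHamiltonian ℂ d} {τ b : ℝ}
    (hHt : hamNorm (fieldWt h (L : ℝ) d k) ((L : ℝ) ^ k) (L ^ (d * k)) Ht ≤ τ)
    (hHt' : hamNorm (fieldWt h (L : ℝ) d k) ((L : ℝ) ^ k) (L ^ (d * k)) Ht' ≤ τ) (hτ : τ ≤ 1 / 16)
    (hH : hamNorm (fieldWt h (L : ℝ) d k) ((L : ℝ) ^ k) (L ^ (d * k)) H ≤ b)
    (hH' : hamNorm (fieldWt h (L : ℝ) d k) ((L : ℝ) ^ k) (L ^ (d * k)) H' ≤ b) (hb : b ≤ 1 / 64)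
    {K K' : Finset (Fin d → ZMod M) → ((Fin d → ZMod M) → ℝ) → ℂ} {C CΔ : ℝ} (hC : 0 ≤ C) (hCΔ : 0 ≤ CΔ)
    (hK : WeakNormLE (abkmNormParams L N Mord R p r₀ h θbar A (schedDelta δ₀ δ₁ N) 𝒞) k K C)
    (hK' : WeakNormLE (abkmNormParams L N Mord R p r₀ h θbar A (schedDelta δ₀ δ₁ N) 𝒞) k K' C)
    (hΔ : WeakNormLE (abkmNormParams L N Mord R p r₀ h θbar A (schedDelta δ₀ δ₁ N) 𝒞) k (K - K') CΔ)
    (hKd : ∀ Y, ContDiff ℝ r₀ (K Y)) (hK'd : ∀ Y, ContDiff ℝ r₀ (K' Y))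
    (hKloc : ∀ Y, IsPolymer (L ^ k) Y → IsConn Y →
      IsGaugeLocal ((abkmNormParams L N Mord R p r₀ h θbar A (schedDelta δ₀ δ₁ N) 𝒞).gauge k Y) (K Y))
    (hK'loc : ∀ Y, IsPolymer (L ^ k) Y → IsConn Y →
      IsGaugeLocal ((abkmNormParams L N Mord R p r₀ h θbar A (schedDelta δ₀ δ₁ N) 𝒞).gauge k Y) (K' Y))
    (hv : pi2BoundConst d (((2 * R + 2 : ℕ) : ℝ) + ((d / 2 + 1 : ℕ) : ℝ)) * (C * A𝒫' * A⁻¹) ≤ 1 / 64)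
    {κ : ℝ}
    (hκ : 1 + Real.exp (1 / 4) +
      16 * Real.exp (3 / 8) * hamNorm (fieldWt h (L : ℝ) d k) ((L : ℝ) ^ k) (L ^ (d * k)) (Ht - Ht') ≤ κ)
    (hκ' : 1 + Real.exp (1 / 4) + 16 * Real.exp (3 / 8) * τ ≤ κ) :
    TayNormLE ((abkmNormParams L N Mord R p r₀ h θbar A (schedDelta δ₀ δ₁ N) 𝒞).gauge (k + 1) U) r₀
      ((abkmWeightData L N Mord R θbar (schedDelta δ₀ δ₁ N) 𝒞).weight (k + 1) U)
      (fun φ => (∑ B ∈ blockPartIndex D U,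
        ((bprod (L ^ k) (fun B' => expNegH Ht B' φ) (U \ B) *
              bprod (L ^ k) (fun B' => expNegH (-Ht) B' φ) (B \ U) - 1) * blockTerm D K B φ +
          bprod (L ^ k) (fun B' => expNegH Ht B' φ) (U \ B) *
              bprod (L ^ k) (fun B' => expNegH (-Ht) B' φ) (B \ U) *
            (fluctDefect D.𝒞 H B φ +
              (expNegH (stepOpA (gradCov D.𝒞) H) B φ - 1) * (1 - Complex.exp (-(eval (opB D K) B φ))) -
              (Complex.exp (-(eval (opB D K) B φ)) - 1 + eval (opB D K) B φ)) +
          bprod (L ^ k) (fun B' => expNegH Ht B' φ) (U \ B) *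
              bprod (L ^ k) (fun B' => expNegH (-Ht) B' φ) (B \ U) *
            fluct D.𝒞 (fun ψ => ∑ Y ∈ ((polys (L ^ k) B).erase B).erase ∅,
              bprod (L ^ k) (fun B' => expNegH H B' ψ - 1) (B \ Y) * K Y ψ) φ)) -
        (∑ B ∈ blockPartIndex D U,
        ((bprod (L ^ k) (fun B' => expNegH Ht' B' φ) (U \ B) *
              bprod (L ^ k) (fun B' => expNegH (-Ht') B' φ) (B \ U) - 1) * blockTerm D K' B φ +
          bprod (L ^ k) (fun B' => expNegH Ht' B' φ) (U \ B) *
              bprod (L ^ k) (fun B' => expNegH (-Ht') B' φ) (B \ U) *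
            (fluctDefect D.𝒞 H' B φ +
              (expNegH (stepOpA (gradCov D.𝒞) H') B φ - 1) * (1 - Complex.exp (-(eval (opB D K') B φ))) -
              (Complex.exp (-(eval (opB D K') B φ)) - 1 + eval (opB D K') B φ)) +
          bprod (L ^ k) (fun B' => expNegH Ht' B' φ) (U \ B) *
              bprod (L ^ k) (fun B' => expNegH (-Ht') B' φ) (B \ U) *
            fluct D.𝒞 (fun ψ => ∑ Y ∈ ((polys (L ^ k) B).erase B).erase ∅,
              bprod (L ^ k) (fun B' => expNegH H' B' ψ - 1) (B \ Y) * K' Y ψ) φ)))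
      ((blocks (L ^ k) U).card * κ ^ (blocks (L ^ k) U).card *
        (16 * Real.exp (3 / 8) * hamNorm (fieldWt h (L : ℝ) d k) ((L : ℝ) ^ k) (L ^ (d * k)) (Ht - Ht') *
            ((1 + 8 * pi2BoundConst d (((2 * R + 2 : ℕ) : ℝ) + ((d / 2 + 1 : ℕ) : ℝ))) * (C * A𝒫' * A⁻¹) +
              256 * Real.exp (1 / 4) * ((A𝒫' + 4) * b ^ 2 +
                2 * b * (pi2BoundConst d (((2 * R + 2 : ℕ) : ℝ) + ((d / 2 + 1 : ℕ) : ℝ)) * (C * A𝒫' * A⁻¹)) +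
                (pi2BoundConst d (((2 * R + 2 : ℕ) : ℝ) + ((d / 2 + 1 : ℕ) : ℝ)) * (C * A𝒫' * A⁻¹)) ^ 2)) +
          16 * Real.exp (3 / 8) * τ *
            ((1 + 8 * pi2BoundConst d (((2 * R + 2 : ℕ) : ℝ) + ((d / 2 + 1 : ℕ) : ℝ))) * (CΔ * A𝒫' * A⁻¹)) +
          (512 * Real.exp (1 / 4) * (A𝒫' + 4) * (b + b) *
              hamNorm (fieldWt h (L : ℝ) d k) ((L : ℝ) ^ k) (L ^ (d * k)) (H - H') +
            512 * Real.exp (1 / 4) *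
              (hamNorm (fieldWt h (L : ℝ) d k) ((L : ℝ) ^ k) (L ^ (d * k)) (H - H') *
                  (pi2BoundConst d (((2 * R + 2 : ℕ) : ℝ) + ((d / 2 + 1 : ℕ) : ℝ)) * (C * A𝒫' * A⁻¹)) +
                b * (pi2BoundConst d (((2 * R + 2 : ℕ) : ℝ) + ((d / 2 + 1 : ℕ) : ℝ)) * (CΔ * A𝒫' * A⁻¹))) +
            256 * Real.exp (1 / 4) *
              (pi2BoundConst d (((2 * R + 2 : ℕ) : ℝ) + ((d / 2 + 1 : ℕ) : ℝ)) * (C * A𝒫' * A⁻¹) +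
                pi2BoundConst d (((2 * R + 2 : ℕ) : ℝ) + ((d / 2 + 1 : ℕ) : ℝ)) * (CΔ * A𝒫' * A⁻¹)) *
              (pi2BoundConst d (((2 * R + 2 : ℕ) : ℝ) + ((d / 2 + 1 : ℕ) : ℝ)) * (CΔ * A𝒫' * A⁻¹))))) := by
  set P := abkmNormParams L N Mord R p r₀ h θbar A (schedDelta δ₀ δ₁ N) 𝒞 with hP
  set W := abkmWeightData L N Mord R θbar (schedDelta δ₀ δ₁ N) 𝒞 with hW
  set 𝒸 := 𝒞 (k + 1) with h𝒸
  set C87 := pi2BoundConst d (((2 * R + 2 : ℕ) : ℝ) + ((d / 2 + 1 : ℕ) : ℝ)) with hC87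
  set v := C87 * (C * A𝒫' * A⁻¹) with hvdef
  set vΔ := C87 * (CΔ * A𝒫' * A⁻¹) with hvΔdef
  set Δt := 16 * Real.exp (3 / 8) * hamNorm (fieldWt h (L : ℝ) d k) ((L : ℝ) ^ k) (L ^ (d * k)) (Ht - Ht') with hΔt
  set g₁ := (1 + 8 * C87) * (C * A𝒫' * A⁻¹) with hg₁
  set ρ₁ := (1 + 8 * C87) * (CΔ * A𝒫' * A⁻¹) with hρ₁
  set gΦ := 256 * Real.exp (1 / 4) * ((A𝒫' + 4) * b ^ 2 + 2 * b * v + v ^ 2) with hgΦ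
  set ρΦ := 512 * Real.exp (1 / 4) * (A𝒫' + 4) * (b + b) *
      hamNorm (fieldWt h (L : ℝ) d k) ((L : ℝ) ^ k) (L ^ (d * k)) (H - H') +
    512 * Real.exp (1 / 4) * (hamNorm (fieldWt h (L : ℝ) d k) ((L : ℝ) ^ k) (L ^ (d * k)) (H - H') * v + b * vΔ) +
    256 * Real.exp (1 / 4) * (v + vΔ) * vΔ with hρΦ
  set 𝓧' := blockPartIndex D U with h𝓧'def
  -- sizes and basic facts
  have hd2 : 2 ≤ d := by omega
  have hL0 : (0 : ℝ) < L := by exact_mod_cast hLodd.pos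
  have hL1 : 1 ≤ L := hLodd.pos
  have hA0 : 0 < A := by linarith
  have hk1 : k + 1 ≤ N + 1 := by omega
  have hk : k ≤ N := by omega
  have hMo : Odd M := by rw [hM]; exact hLodd.pow
  have hsodd : Odd (L ^ k) := hLodd.pow
  have h𝔥 : 0 < fieldWt h (L : ℝ) d k := fieldWt_pos hh hL0 d k
  have hRk : (0 : ℝ) < (L : ℝ) ^ k := by positivity
  have hnn : ∀ G : RelevantHamiltonian ℂ d, 0 ≤ hamNorm (fieldWt h (L : ℝ) d k) ((L : ℝ) ^ k) (L ^ (d * k)) G :=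
    fun G => hamNorm_nonneg h𝔥.le hRk.le _ _
  have hτ0 : 0 ≤ τ := (hnn Ht).trans hHt
  have hb0 : 0 ≤ b := (hnn H).trans hH
  have hC87_0 : 0 ≤ C87 := pi2BoundConst_nonneg d (by positivity)
  have hAinv : 0 ≤ A⁻¹ := inv_nonneg.2 hA0.le
  have hv0 : 0 ≤ v := by positivity
  have hvΔ0 : 0 ≤ vΔ := by positivity
  have hg₁0 : 0 ≤ g₁ := by positivity
  have hρ₁0 : 0 ≤ ρ₁ := by positivity
  have hgΦ0 : 0 ≤ gΦ := by positivity
  have hnHH0 := hnn (H - H')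
  have hρΦ0 : 0 ≤ ρΦ := by positivity
  have hΔt0 : 0 ≤ Δt := by have := hnn (Ht - Ht'); positivity
  have hγ : ∀ q, ((L ^ (d * k) : ℕ) : ℝ) * |gradCov D.𝒞 q| ≤ h ^ 2 := fun q =>
    abs_gradCov_le_of_stepKernelBounds hS hh2 q
  -- the index set: single blocks inside `U`
  have h𝓧' : 𝓧' ⊆ (polys (L ^ k) univ).filter (fun X => reblock (L ^ k) (L * L ^ k) X = U) := by
    have h := filter_reblock_isConn_card_eq_one D hMo (by rw [hDs]; exact hsodd) (by rw [hDL]; exact hLodd) U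
    rw [hDs, hDL] at h
    rw [h𝓧'def, ← h]
    exact filter_subset _ _
  have hblk : ∀ X ∈ 𝓧', ∃ y, X = blockOf (L ^ k) y := fun X hX => by
    have h := blockPartIndex_subset_blocks D U hX
    rw [hDs] at h
    obtain ⟨y, -, rfl⟩ := mem_blocks.1 h
    exact ⟨y, rfl⟩
  have hXU : ∀ X ∈ 𝓧', X ⊆ U := fun X hX => by
    have h := blockPartIndex_subset_blocks D U hX
    rw [hDs] at h
    obtain ⟨y, hy, rfl⟩ := mem_blocks.1 h
    have hUk : IsPolymer (L ^ k) U := by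
      have : IsPolymer (L * L ^ k) U := by rw [show L * L ^ k = L ^ (k + 1) by rw [pow_succ']]; exact hU
      exact this.of_mul hsodd hLodd
    exact hUk y hy
  have hcard𝓧' : (𝓧'.card : ℝ) ≤ (blocks (L ^ k) U).card := by
    have h := blockPartIndex_subset_blocks D U
    rw [hDs] at h
    exact_mod_cast card_le_card h
  -- the extracted Hamiltonians `V = B_kK`, `V' = B_kK'`
  have hVle : hamNorm (fieldWt h (L : ℝ) d k) ((L : ℝ) ^ k) (L ^ (d * k)) (opB D K) ≤ v :=
    hamNorm_opB_abkm_le_scale_of_stepKernelBounds hLodd hL hM hkN hpR hr₀ hB hh hA1 D hS hB₀ hc₀ hC hK hKd hKloc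
  have hV'le : hamNorm (fieldWt h (L : ℝ) d k) ((L : ℝ) ^ k) (L ^ (d * k)) (opB D K') ≤ v :=
    hamNorm_opB_abkm_le_scale_of_stepKernelBounds hLodd hL hM hkN hpR hr₀ hB hh hA1 D hS hB₀ hc₀ hC hK' hK'd hK'loc
  have hKΔd : ∀ Y, ContDiff ℝ r₀ ((K - K') Y) := fun Y => by
    show ContDiff ℝ r₀ (K Y - K' Y); exact (hKd Y).sub (hK'd Y)
  have hKΔloc : ∀ Y, IsPolymer (L ^ k) Y → IsConn Y → IsGaugeLocal (P.gauge k Y) ((K - K') Y) :=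
    fun Y hY hc φ ψ e => by
      show (K Y - K' Y) φ = (K Y - K' Y) ψ
      simp only [Pi.sub_apply]
      rw [hKloc Y hY hc φ ψ e, hK'loc Y hY hc φ ψ e]
  have hVsub : opB D K - opB D K' = opB D (K - K') :=
    opB_sub_abkm_of_stepKernelBounds hB hr₀ hLodd hM hA0 D hS hB₀ hC hC hK hK' hKd hK'd hKloc hK'loc
  have hVΔle : hamNorm (fieldWt h (L : ℝ) d k) ((L : ℝ) ^ k) (L ^ (d * k)) (opB D K - opB D K') ≤ vΔ := by
    rw [hVsub]
    exact hamNorm_opB_abkm_le_scale_of_stepKernelBounds hLodd hL hM hkN hpR hr₀ hB hh hA1 D hS hB₀ hc₀ hCΔ hΔ hKΔd hKΔloc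
  have hv64 : v ≤ 1 / 64 := hv
  have hH64 : hamNorm (fieldWt h (L : ℝ) d k) ((L : ℝ) ^ k) (L ^ (d * k)) H ≤ 1 / 64 := hH.trans hb
  have hH'64 : hamNorm (fieldWt h (L : ℝ) d k) ((L : ℝ) ^ k) (L ^ (d * k)) H' ≤ 1 / 64 := hH'.trans hb
  have hH32 : hamNorm (fieldWt h (L : ℝ) d k) ((L : ℝ) ^ k) (L ^ (d * k)) H ≤ 1 / 32 := hH64.trans (by norm_num)
  have hH8 : hamNorm (fieldWt h (L : ℝ) d k) ((L : ℝ) ^ k) (L ^ (d * k)) H ≤ 1 / 8 := hH64.trans (by norm_num)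
  have hH'8 : hamNorm (fieldWt h (L : ℝ) d k) ((L : ℝ) ^ k) (L ^ (d * k)) H' ≤ 1 / 8 := hH'64.trans (by norm_num)
  have hV64 : hamNorm (fieldWt h (L : ℝ) d k) ((L : ℝ) ^ k) (L ^ (d * k)) (opB D K) ≤ 1 / 64 := hVle.trans hv64
  have hV'64 : hamNorm (fieldWt h (L : ℝ) d k) ((L : ℝ) ^ k) (L ^ (d * k)) (opB D K') ≤ 1 / 64 := hV'le.trans hv64
  have hV16 : hamNorm (fieldWt h (L : ℝ) d k) ((L : ℝ) ^ k) (L ^ (d * k)) (opB D K) ≤ 1 / 16 := hV64.trans (by norm_num)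
  -- (1) the `(p_B − 1)·blockTerm(B)` terms
  have h1 := tayNormLE_subsum_pMinusOne_sub_abkm_slot (n := n) (lam := lam) (μ := μ) (θbar := θbar) (p := p) (r₀ := r₀)
    (A := A) hd hLodd hL hR2
    hM hkN hp hMord hB hδ₀ hδ₁ hh hh0 hU h𝓧' hHt hHt' hτ
    (Gs := fun X φ => blockTerm D K X φ) (Gs' := fun X φ => blockTerm D K' X φ) (g := fun _ => g₁) (ρ := fun _ => ρ₁)
    (fun X hX X₁ hX₁ => by
      rw [mem_singleton.1 hX₁, sdiff_empty]
      obtain ⟨y, rfl⟩ := hblk X hX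
      exact tayNormLE_blockTerm_abkm_of_stepKernelBounds hd2 hLodd hL hM hkN hp hpR hMord hr₀ hB hδ₀ hδ₁ hh hh0 hA1 D hS
        hB₀ hc₀ y hC hK hKd hKloc)
    (fun X hX X₁ hX₁ => by
      rw [mem_singleton.1 hX₁, sdiff_empty]
      obtain ⟨y, rfl⟩ := hblk X hX
      exact tayNormLE_blockTerm_sub_abkm_of_stepKernelBounds hd2 hLodd hL hM hkN hp hpR hMord hr₀ hB hδ₀ hδ₁ hh hh0 hA1 D hS hB₀ hc₀ y hC hCΔ hK hK' hΔ hKd hK'd hKloc hK'loc)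
    (fun X hX X₁ hX₁ => by
      rw [mem_singleton.1 hX₁, sdiff_empty]
      obtain ⟨y, rfl⟩ := hblk X hX
      exact contDiff_blockTerm_abkm_of_stepKernelBounds hB hLodd hM hA0 D hS y hC hK hKd hKloc)
    (fun X hX X₁ hX₁ => by
      rw [mem_singleton.1 hX₁, sdiff_empty]
      obtain ⟨y, rfl⟩ := hblk X hX
      exact contDiff_blockTerm_abkm_of_stepKernelBounds hB hLodd hM hA0 D hS y hC hK' hK'd hK'loc)
    (fun X hX X₁ hX₁ => by
      rw [mem_singleton.1 hX₁, sdiff_empty]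
      obtain ⟨y, rfl⟩ := hblk X hX
      exact isGaugeLocal_blockTerm_abkm hLodd hh hp k D y
        (hKloc _ (isPolymer_blockOf _ y) (TorusPolymer.isConn_blockOf hMo hsodd y)))
    (fun X hX X₁ hX₁ => by
      rw [mem_singleton.1 hX₁, sdiff_empty]
      obtain ⟨y, rfl⟩ := hblk X hX
      exact isGaugeLocal_blockTerm_abkm hLodd hh hp k D y
        (hK'loc _ (isPolymer_blockOf _ y) (TorusPolymer.isConn_blockOf hMo hsodd y)))
    (fun _ _ _ _ => hg₁0) (fun _ _ _ _ => hρ₁0)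
  -- (2) the `p_B·Φ_B` terms
  have h𝓨 : ∀ X ∈ 𝓧', ({∅} : Finset (Finset (Fin d → ZMod M))) ⊆ polys (L ^ k) X := fun X _ => by
    intro X₁ hX₁; rw [mem_singleton.1 hX₁]; exact empty_mem_polys _ _
  have h2 := tayNormLE_subsum_reblockTerm_sub_abkm_slot (n := n) (lam := lam) (μ := μ) (θbar := θbar) (p := p) (r₀ := r₀)
    (A := A) hd hLodd hL hR2
    hM hkN hp hMord hB hδ₀ hδ₁ hh hh0 hU h𝓧' (𝓨 := fun _ => ({∅} : Finset (Finset (Fin d → ZMod M)))) h𝓨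
    hHt hHt' hτ
    (Gs := fun X φ => fluctDefect D.𝒞 H X φ +
        (expNegH (stepOpA (gradCov D.𝒞) H) X φ - 1) * (1 - Complex.exp (-(eval (opB D K) X φ))) -
        (Complex.exp (-(eval (opB D K) X φ)) - 1 + eval (opB D K) X φ))
    (Gs' := fun X φ => fluctDefect D.𝒞 H' X φ +
        (expNegH (stepOpA (gradCov D.𝒞) H') X φ - 1) * (1 - Complex.exp (-(eval (opB D K') X φ))) -
        (Complex.exp (-(eval (opB D K') X φ)) - 1 + eval (opB D K') X φ))
    (g := fun _ => gΦ) (ρ := fun _ => ρΦ)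
    (fun X hX X₁ hX₁ => by
      rw [mem_singleton.1 hX₁, sdiff_empty]
      obtain ⟨y, rfl⟩ := hblk X hX
      refine (tayNormLE_blockBracket_abkm_of_stepKernelBounds (p := p) (r₀ := r₀) (A := A) hd2 hB hLodd hM hk hS hδ₀ hδ₁ hh hh0
        hMord hp hγ y (H := H) (V := opB D K) hH32 hV16).mono ?_
        (fun φ => (W.midWeight_pos k _ φ).le)
      rw [hgΦ]
      have e1 : hamNorm (fieldWt h (L : ℝ) d k) ((L : ℝ) ^ k) (L ^ (d * k)) H ^ 2 ≤ b ^ 2 :=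
        pow_le_pow_left₀ (hnn H) hH 2
      have e2 : hamNorm (fieldWt h (L : ℝ) d k) ((L : ℝ) ^ k) (L ^ (d * k)) (opB D K) ^ 2 ≤ v ^ 2 :=
        pow_le_pow_left₀ (hnn _) hVle 2
      have e3 : hamNorm (fieldWt h (L : ℝ) d k) ((L : ℝ) ^ k) (L ^ (d * k)) H *
          hamNorm (fieldWt h (L : ℝ) d k) ((L : ℝ) ^ k) (L ^ (d * k)) (opB D K) ≤ b * v :=
        mul_le_mul hH hVle (hnn _) hb0
      have hA4 : 0 ≤ A𝒫' + 4 := by positivity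
      refine mul_le_mul_of_nonneg_left ?_ (by positivity)
      have e1' := mul_le_mul_of_nonneg_left e1 hA4
      have e3' := mul_le_mul_of_nonneg_left e3 (show (0 : ℝ) ≤ 2 by norm_num)
      linarith [e1', e2, e3'])
    (fun X hX X₁ hX₁ => by
      rw [mem_singleton.1 hX₁, sdiff_empty]
      obtain ⟨y, rfl⟩ := hblk X hX
      refine (tayNormLE_blockBracket_sub_abkm_of_stepKernelBounds (p := p) (r₀ := r₀) (A := A) hd2 hB hA𝒫 hLodd hM hk hS hδ₀ hδ₁
        hh hh0 hMord hp hγ y (H := H) (H' := H') (V := opB D K) (V' := opB D K') hH64 hH'64 hV64 hV'64).mono ?_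
        (fun φ => (W.midWeight_pos k _ φ).le)
      rw [hρΦ]
      have he : 0 ≤ 256 * Real.exp (1 / 4) := by positivity
      have he' : 0 ≤ 512 * Real.exp (1 / 4) := by positivity
      have hA4 : 0 ≤ A𝒫' + 4 := by positivity
      have e1 : (hamNorm (fieldWt h (L : ℝ) d k) ((L : ℝ) ^ k) (L ^ (d * k)) H +
            hamNorm (fieldWt h (L : ℝ) d k) ((L : ℝ) ^ k) (L ^ (d * k)) H') *
          hamNorm (fieldWt h (L : ℝ) d k) ((L : ℝ) ^ k) (L ^ (d * k)) (H - H') ≤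
          (b + b) * hamNorm (fieldWt h (L : ℝ) d k) ((L : ℝ) ^ k) (L ^ (d * k)) (H - H') :=
        mul_le_mul_of_nonneg_right (add_le_add hH hH') hnHH0
      have e2 : hamNorm (fieldWt h (L : ℝ) d k) ((L : ℝ) ^ k) (L ^ (d * k)) (H - H') *
            hamNorm (fieldWt h (L : ℝ) d k) ((L : ℝ) ^ k) (L ^ (d * k)) (opB D K) ≤
          hamNorm (fieldWt h (L : ℝ) d k) ((L : ℝ) ^ k) (L ^ (d * k)) (H - H') * v :=
        mul_le_mul_of_nonneg_left hVle hnHH0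
      have e3 : hamNorm (fieldWt h (L : ℝ) d k) ((L : ℝ) ^ k) (L ^ (d * k)) H' *
            hamNorm (fieldWt h (L : ℝ) d k) ((L : ℝ) ^ k) (L ^ (d * k)) (opB D K - opB D K') ≤ b * vΔ :=
        mul_le_mul hH' hVΔle (hnn _) hb0
      have e4 : (hamNorm (fieldWt h (L : ℝ) d k) ((L : ℝ) ^ k) (L ^ (d * k)) (opB D K') +
            hamNorm (fieldWt h (L : ℝ) d k) ((L : ℝ) ^ k) (L ^ (d * k)) (opB D K - opB D K')) *
          hamNorm (fieldWt h (L : ℝ) d k) ((L : ℝ) ^ k) (L ^ (d * k)) (opB D K - opB D K') ≤ (v + vΔ) * vΔ :=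
        mul_le_mul (add_le_add hV'le hVΔle) hVΔle (hnn _) (by positivity)
      have f1 := mul_le_mul_of_nonneg_left e1 (mul_nonneg he' hA4)
      have f2 := mul_le_mul_of_nonneg_left e2 he'
      have f3 := mul_le_mul_of_nonneg_left e3 he'
      have f4 := mul_le_mul_of_nonneg_left e4 he
      linarith [f1, f2, f3, f4])
    (fun X hX X₁ hX₁ => by
      rw [mem_singleton.1 hX₁, sdiff_empty]
      obtain ⟨y, rfl⟩ := hblk X hX
      exact contDiff_blockBracket_abkm_of_stepKernelBounds (p := p) (r₀ := r₀) (A := A) hd2 hB hLodd hM hk hS hδ₀ hδ₁ hh hh0 hMord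
        hp y (opB D K) hH8)
    (fun X hX X₁ hX₁ => by
      rw [mem_singleton.1 hX₁, sdiff_empty]
      obtain ⟨y, rfl⟩ := hblk X hX
      exact contDiff_blockBracket_abkm_of_stepKernelBounds (p := p) (r₀ := r₀) (A := A) hd2 hB hLodd hM hk hS hδ₀ hδ₁ hh hh0 hMord
        hp y (opB D K') hH'8)
    (fun X hX X₁ hX₁ => by
      rw [mem_singleton.1 hX₁, sdiff_empty]
      obtain ⟨y, rfl⟩ := hblk X hX
      exact isGaugeLocal_blockBracket_abkm_of_stepKernelBounds hLodd hh hp k y H (opB D K))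
    (fun X hX X₁ hX₁ => by
      rw [mem_singleton.1 hX₁, sdiff_empty]
      obtain ⟨y, rfl⟩ := hblk X hX
      exact isGaugeLocal_blockBracket_abkm_of_stepKernelBounds hLodd hh hp k y H' (opB D K'))
    (fun _ _ _ _ => hgΦ0) (fun _ _ _ _ => hρΦ0)
  -- smoothness of the two summed functionals
  have hcdE : ∀ (H₀ : RelevantHamiltonian ℂ d) (Z : Finset (Fin d → ZMod M)),
      ContDiff ℝ r₀ (fun φ : (Fin d → ZMod M) → ℝ => bprod (L ^ k) (fun B => expNegH H₀ B φ) Z) := by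
    intro H₀ Z
    unfold TorusPolymer.bprod
    exact contDiff_prod fun B _ => (contDiff_eval H₀ B (n := r₀)).neg.cexp
  have hcd3 : ∀ (H₀ : RelevantHamiltonian ℂ d) (Z : Finset (Fin d → ZMod M)),
      ContDiff ℝ r₀ (fun φ : (Fin d → ZMod M) → ℝ => bprod (L ^ k) (fun B => 1 - expNegH H₀ B φ) Z) := by
    intro H₀ Z
    unfold TorusPolymer.bprod
    exact contDiff_prod fun B _ => contDiff_const.sub (contDiff_eval H₀ B (n := r₀)).neg.cexp
  have hGd : ∀ X ∈ 𝓧', ContDiff ℝ r₀ (blockTerm D K X) ∧ ContDiff ℝ r₀ (blockTerm D K' X) := fun X hX => by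
    obtain ⟨y, rfl⟩ := hblk X hX
    exact ⟨contDiff_blockTerm_abkm_of_stepKernelBounds hB hLodd hM hA0 D hS y hC hK hKd hKloc,
      contDiff_blockTerm_abkm_of_stepKernelBounds hB hLodd hM hA0 D hS y hC hK' hK'd hK'loc⟩
  have hΦd : ∀ X ∈ 𝓧', ∀ (H₀ : RelevantHamiltonian ℂ d) (K₀ : Finset (Fin d → ZMod M) → ((Fin d → ZMod M) → ℝ) → ℂ),
      hamNorm (fieldWt h (L : ℝ) d k) ((L : ℝ) ^ k) (L ^ (d * k)) H₀ ≤ 1 / 8 →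
      ContDiff ℝ r₀ (fun φ => fluctDefect D.𝒞 H₀ X φ +
        (expNegH (stepOpA (gradCov D.𝒞) H₀) X φ - 1) * (1 - Complex.exp (-(eval (opB D K₀) X φ))) -
        (Complex.exp (-(eval (opB D K₀) X φ)) - 1 + eval (opB D K₀) X φ)) := fun X hX H₀ K₀ hH₀ => by
    obtain ⟨y, rfl⟩ := hblk X hX
    exact contDiff_blockBracket_abkm_of_stepKernelBounds (p := p) (r₀ := r₀) (A := A) hd2 hB hLodd hM hk hS hδ₀ hδ₁ hh hh0 hMord hp
      y (opB D K₀) hH₀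
  have hcd1 : ContDiff ℝ r₀ (fun φ : (Fin d → ZMod M) → ℝ => ∑ X ∈ 𝓧',
      ((bprod (L ^ k) (fun B => expNegH Ht B φ) (U \ X) * bprod (L ^ k) (fun B => expNegH (-Ht) B φ) (X \ U) - 1) *
          blockTerm D K X φ -
        (bprod (L ^ k) (fun B => expNegH Ht' B φ) (U \ X) * bprod (L ^ k) (fun B => expNegH (-Ht') B φ) (X \ U) - 1) *
          blockTerm D K' X φ)) := by
    refine ContDiff.sum fun X hX => ?_
    exact ((((hcdE Ht (U \ X)).mul (hcdE (-Ht) (X \ U))).sub contDiff_const).mul (hGd X hX).1).sub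
      ((((hcdE Ht' (U \ X)).mul (hcdE (-Ht') (X \ U))).sub contDiff_const).mul (hGd X hX).2)
  have hcd2 : ContDiff ℝ r₀ (fun φ : (Fin d → ZMod M) → ℝ => ∑ X ∈ 𝓧',
      ∑ X₁ ∈ ({∅} : Finset (Finset (Fin d → ZMod M))),
        (bprod (L ^ k) (fun B => expNegH Ht B φ) (U \ X) * bprod (L ^ k) (fun B => expNegH (-Ht) B φ) (X \ U) *
            (bprod (L ^ k) (fun B => 1 - expNegH Ht B φ) X₁ *
              (fluctDefect D.𝒞 H (X \ X₁) φ +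
                (expNegH (stepOpA (gradCov D.𝒞) H) (X \ X₁) φ - 1) *
                  (1 - Complex.exp (-(eval (opB D K) (X \ X₁) φ))) -
                (Complex.exp (-(eval (opB D K) (X \ X₁) φ)) - 1 + eval (opB D K) (X \ X₁) φ))) -
          bprod (L ^ k) (fun B => expNegH Ht' B φ) (U \ X) * bprod (L ^ k) (fun B => expNegH (-Ht') B φ) (X \ U) *
            (bprod (L ^ k) (fun B => 1 - expNegH Ht' B φ) X₁ *
              (fluctDefect D.𝒞 H' (X \ X₁) φ +
                (expNegH (stepOpA (gradCov D.𝒞) H') (X \ X₁) φ - 1) *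
                  (1 - Complex.exp (-(eval (opB D K') (X \ X₁) φ))) -
                (Complex.exp (-(eval (opB D K') (X \ X₁) φ)) - 1 + eval (opB D K') (X \ X₁) φ))))) := by
    refine ContDiff.sum fun X hX => ContDiff.sum fun X₁ hX₁ => ?_
    have e := mem_singleton.1 hX₁
    subst e
    simp only [sdiff_empty]
    exact (((hcdE Ht (U \ X)).mul (hcdE (-Ht) (X \ U))).mul ((hcd3 Ht ∅).mul
      (hΦd X hX H K hH8))).sub
      (((hcdE Ht' (U \ X)).mul (hcdE (-Ht') (X \ U))).mul ((hcd3 Ht' ∅).mul (hΦd X hX H' K' hH'8)))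
  have hsum := h1.add h2 hcd1 hcd2
  -- the `rest(B)` terms vanish on blocks
  have hrest : ∀ X ∈ 𝓧', ∀ (H₀ : RelevantHamiltonian ℂ d) (K₀ : Finset (Fin d → ZMod M) → ((Fin d → ZMod M) → ℝ) → ℂ)
      (φ : (Fin d → ZMod M) → ℝ),
      fluct D.𝒞 (fun ψ => ∑ Y ∈ ((polys (L ^ k) X).erase X).erase ∅,
        bprod (L ^ k) (fun B' => expNegH H₀ B' ψ - 1) (X \ Y) * K₀ Y ψ) φ = 0 := by
    intro X hX H₀ K₀ φ
    obtain ⟨y, rfl⟩ := hblk X hX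
    have hf : (fun ψ : (Fin d → ZMod M) → ℝ => ∑ Y ∈ ((polys (L ^ k) (blockOf (L ^ k) y)).erase (blockOf (L ^ k) y)).erase ∅,
        bprod (L ^ k) (fun B' => expNegH H₀ B' ψ - 1) (blockOf (L ^ k) y \ Y) * K₀ Y ψ) = fun _ => (0 : ℂ) := by
      funext ψ; exact sum_rest_blockOf_eq_zero _ _ _
    rw [hf, fluct_const]
  -- identify the function and bound the constant
  intro φ
  have key := hsum φ
  refine le_trans (le_of_eq_of_le ?_ key) (mul_le_mul_of_nonneg_right ?_ (W.weight_pos (k + 1) U φ).le)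
  · -- the function
    congr 1
    funext ψ
    simp only [Pi.add_apply]
    rw [← sum_sub_distrib, ← sum_add_distrib]
    refine sum_congr rfl fun X hX => ?_
    rw [sum_singleton, hrest X hX H K ψ, hrest X hX H' K' ψ]
    simp only [sdiff_empty, bprod_empty, mul_zero, add_zero, one_mul]
    ring
  · -- the constant: every summand `(X, ∅)` is at most `κ^{|U|_k}(δ g + ρ)`
    clear key hsum hcd1 hcd2 h1 h2
    have ha0 : 0 ≤ Real.exp (1 / 4) := (Real.exp_pos _).le
    have hκ1 : 1 ≤ κ := by linarith [hκ', hτ0, Real.exp_pos (1 / 4), Real.exp_pos (3 / 8)]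
    have hm : ∀ X ∈ 𝓧', (blocks (L ^ k) (U \ X)).card ≤ (blocks (L ^ k) U).card := fun X _ =>
      card_le_card (blocks_mono _ sdiff_subset)
    have hS : ∀ X ∈ 𝓧', ∀ X₁ ∈ ({∅} : Finset (Finset (Fin d → ZMod M))), ∀ (δ g ρ : ℝ), 0 ≤ δ → 0 ≤ g → 0 ≤ ρ →
        1 + Real.exp (1 / 4) + δ ≤ κ →
        (((∏ _B ∈ blocks (L ^ k) (U \ X), (Real.exp (1 / 4) + δ)) - ∏ _B ∈ blocks (L ^ k) (U \ X), Real.exp (1 / 4)) *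
            (∏ _B ∈ blocks (L ^ k) (X \ U), Real.exp (1 / 4)) *
            ((∏ _B ∈ blocks (L ^ k) X₁, 8 * Real.exp (1 / 4) * τ) * g) +
          (∏ _B ∈ blocks (L ^ k) (U \ X), Real.exp (1 / 4)) *
            ((∏ _B ∈ blocks (L ^ k) (X \ U), (Real.exp (1 / 4) + δ)) - ∏ _B ∈ blocks (L ^ k) (X \ U), Real.exp (1 / 4)) *
            ((∏ _B ∈ blocks (L ^ k) X₁, 8 * Real.exp (1 / 4) * τ) * g) +
          (∏ _B ∈ blocks (L ^ k) (U \ X), Real.exp (1 / 4)) * (∏ _B ∈ blocks (L ^ k) (X \ U), Real.exp (1 / 4)) *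
            (((∏ _B ∈ blocks (L ^ k) X₁, (8 * Real.exp (1 / 4) * τ + δ)) -
              ∏ _B ∈ blocks (L ^ k) X₁, 8 * Real.exp (1 / 4) * τ) * g) +
          (∏ _B ∈ blocks (L ^ k) (U \ X), Real.exp (1 / 4)) * (∏ _B ∈ blocks (L ^ k) (X \ U), Real.exp (1 / 4)) *
            ((∏ _B ∈ blocks (L ^ k) X₁, 8 * Real.exp (1 / 4) * τ) * ρ)) ≤
          κ ^ (blocks (L ^ k) U).card * (δ * g + ρ) := by
      intro X hX X₁ hX₁ δ g ρ hδ hg hρ hκδ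
      have e1 := mem_singleton.1 hX₁
      subst e1
      have hXU0 : X \ U = ∅ := sdiff_eq_empty_iff_subset.2 (hXU X hX)
      rw [hXU0]
      simp only [blocks_empty, prod_empty]
      have hn := hm X hX
      have hκa : Real.exp (1 / 4) ≤ κ := by linarith
      have he : (∏ _B ∈ blocks (L ^ k) (U \ X), (Real.exp (1 / 4) + δ)) - ∏ _B ∈ blocks (L ^ k) (U \ X), Real.exp (1 / 4) ≤
          δ * κ ^ (blocks (L ^ k) U).card := by
        rw [prod_const, prod_const]
        refine (add_pow_sub_pow_le ha0 hδ _).trans (mul_le_mul_of_nonneg_left ?_ hδ)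
        exact (pow_le_pow_left₀ (by positivity) hκδ _).trans (pow_le_pow_right₀ hκ1 hn)
      have ha : ∏ _B ∈ blocks (L ^ k) (U \ X), Real.exp (1 / 4) ≤ κ ^ (blocks (L ^ k) U).card := by
        rw [prod_const]
        exact (pow_le_pow_left₀ ha0 hκa _).trans (pow_le_pow_right₀ hκ1 hn)
      have key : ((∏ _B ∈ blocks (L ^ k) (U \ X), (Real.exp (1 / 4) + δ)) - ∏ _B ∈ blocks (L ^ k) (U \ X), Real.exp (1 / 4)) * g +
          (∏ _B ∈ blocks (L ^ k) (U \ X), Real.exp (1 / 4)) * ρ ≤ κ ^ (blocks (L ^ k) U).card * (δ * g + ρ) := by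
        calc _ ≤ δ * κ ^ (blocks (L ^ k) U).card * g + κ ^ (blocks (L ^ k) U).card * ρ :=
              add_le_add (mul_le_mul_of_nonneg_right he hg) (mul_le_mul_of_nonneg_right ha hρ)
          _ = κ ^ (blocks (L ^ k) U).card * (δ * g + ρ) := by ring
      linarith [key]
    -- the two `δ`'s
    have hΔ₀ : 16 * Real.exp (3 / 8) * hamNorm (fieldWt h (L : ℝ) d k) ((L : ℝ) ^ k) (L ^ (d * k)) (Ht' - 0) ≤
        16 * Real.exp (3 / 8) * τ := by
      rw [sub_zero]; exact mul_le_mul_of_nonneg_left hHt' (by positivity)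
    have hΔ₀0 : 0 ≤ 16 * Real.exp (3 / 8) * hamNorm (fieldWt h (L : ℝ) d k) ((L : ℝ) ^ k) (L ^ (d * k)) (Ht' - 0) := by
      have := hnn (Ht' - 0); positivity
    have hκΔ₀ : 1 + Real.exp (1 / 4) +
        16 * Real.exp (3 / 8) * hamNorm (fieldWt h (L : ℝ) d k) ((L : ℝ) ^ k) (L ^ (d * k)) (Ht' - 0) ≤ κ := by linarith
    have hκm : 0 ≤ κ ^ (blocks (L ^ k) U).card := by positivity
    -- sum over the blocks
    have hb1 := sum_le_sum fun X hX => sum_le_sum fun X₁ hX₁ => hS X hX X₁ hX₁ _ g₁ 0 hΔt0 hg₁0 le_rfl hκ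
    have hb2 := sum_le_sum fun X hX => sum_le_sum fun X₁ hX₁ => hS X hX X₁ hX₁ _ ρ₁ 0 hΔ₀0 hρ₁0 le_rfl hκΔ₀
    have hb3 := sum_le_sum fun X hX => sum_le_sum fun X₁ hX₁ => hS X hX X₁ hX₁ _ gΦ ρΦ hΔt0 hgΦ0 hρΦ0 hκ
    refine (add_le_add (add_le_add hb1 hb2) hb3).trans ?_
    simp only [sum_singleton]
    simp only [sum_const, nsmul_eq_mul]
    have hc0 : (0 : ℝ) ≤ 𝓧'.card := Nat.cast_nonneg _
    have e2 : κ ^ (blocks (L ^ k) U).card *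
        (16 * Real.exp (3 / 8) * hamNorm (fieldWt h (L : ℝ) d k) ((L : ℝ) ^ k) (L ^ (d * k)) (Ht' - 0) * ρ₁ + 0) ≤
        κ ^ (blocks (L ^ k) U).card * (16 * Real.exp (3 / 8) * τ * ρ₁) := by
      rw [add_zero]; exact mul_le_mul_of_nonneg_left (mul_le_mul_of_nonneg_right hΔ₀ hρ₁0) hκm
    have e3 : (𝓧'.card : ℝ) * (κ ^ (blocks (L ^ k) U).card *
        (16 * Real.exp (3 / 8) * hamNorm (fieldWt h (L : ℝ) d k) ((L : ℝ) ^ k) (L ^ (d * k)) (Ht' - 0) * ρ₁ + 0)) ≤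
        (𝓧'.card : ℝ) * (κ ^ (blocks (L ^ k) U).card * (16 * Real.exp (3 / 8) * τ * ρ₁)) :=
      mul_le_mul_of_nonneg_left e2 hc0
    have e4 : (𝓧'.card : ℝ) * (κ ^ (blocks (L ^ k) U).card *
        (Δt * (g₁ + gΦ) + 16 * Real.exp (3 / 8) * τ * ρ₁ + ρΦ)) ≤
        ((blocks (L ^ k) U).card : ℝ) * (κ ^ (blocks (L ^ k) U).card *
        (Δt * (g₁ + gΦ) + 16 * Real.exp (3 / 8) * τ * ρ₁ + ρΦ)) :=
      mul_le_mul_of_nonneg_right hcard𝓧' (mul_nonneg hκm (add_nonneg (add_nonneg (mul_nonneg hΔt0 (add_nonneg hg₁0 hgΦ0))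
        (mul_nonneg (mul_nonneg (by positivity) hτ0) hρ₁0)) hρΦ0))
    refine (add_le_add (add_le_add le_rfl e3) le_rfl).trans (le_trans (le_of_eq ?_) (e4.trans (le_of_eq (by ring))))
    ring

/-- **`Σ₁` in final form**: the block-sum Lipschitz bound `tayNormLE_remainderOne_sub_abkm_of_stepKernelBounds` for `H̃ = nextH D H K`,
`H̃' = nextH D H' K'`, with `‖H̃ − H̃'‖ ≤ 2‖H−H'‖ + v_Δ`, `‖H̃‖,‖H̃'‖ ≤ 2b + v` substituted, and multiplied by
`A · A^{−|U|_{k+1}}` (`= 1` on the single `(k+1)`-blocks where the block sum lives, the sum being empty otherwise).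
[cite: AdamsBuchholzKoteckyMuller2019, Theorem 6.8 / Lemma 9.6 (proof, first order)] -/
theorem tayNormLE_remainderOne_sub_abkm_final_of_stepKernelBounds {L N Mord R n p r₀ : ℕ} {θbar lam μ δ₁ δ₀ A𝒫 A𝒫' C₂ h A : ℝ}
    {𝒞 : ℕ → (Fin d → ZMod M) → ℝ} (hd : 3 ≤ d) (hLodd : Odd L) (hL : 2 ^ (d + 3) + 16 * R ≤ L)
    (hR2 : 2 ≤ R) (hM : M = L ^ N) {k : ℕ} (hkN : k + 1 ≤ N)
    (hp1 : d / 2 + 1 ≤ p) (hpR : p ≤ R) (hMord : d / 2 + 1 ≤ Mord) (hr₀2 : 2 ≤ r₀)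
   
    (hB : AbkmWeightBounds L N Mord R n θbar lam μ δ₁ δ₀ A𝒫 𝒞
      (abkmWeightData L N Mord R θbar (schedDelta δ₀ δ₁ N) 𝒞))
    (hδ₀ : 0 < δ₀) (hδ₁ : 0 < δ₁) (hh : 0 < h) (hh0 : hZeroSq d R δ₀ δ₁ ≤ h ^ 2)
   
    (hh2 : C₂ ≤ h ^ 2) (hA𝒫 : 0 ≤ A𝒫') (hA1 : 1 ≤ A)
    (D : StepData d M) (hDs : D.s = L ^ k) (hDL : D.L = L) (hS : StepKernelBounds (abkmWeightData L N Mord R θbar (schedDelta δ₀ δ₁ N) 𝒞) L k A𝒫' C₂ D.𝒞)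
    {x₀ : Fin d → ZMod M} (hB₀ : D.B₀ = blockOf (L ^ k) x₀) (hc₀ : D.c₀ = boxCorner (L ^ k) (starRad R L d k) x₀)
    {U : Finset (Fin d → ZMod M)} (hU : IsPolymer (L ^ (k + 1)) U)
    {H H' : RelevantHamiltonian ℂ d} {b : ℝ}
    (hH : hamNorm (fieldWt h (L : ℝ) d k) ((L : ℝ) ^ k) (L ^ (d * k)) H ≤ b)
    (hH' : hamNorm (fieldWt h (L : ℝ) d k) ((L : ℝ) ^ k) (L ^ (d * k)) H' ≤ b) (hb : b ≤ 1 / 64)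
    {K K' : Finset (Fin d → ZMod M) → ((Fin d → ZMod M) → ℝ) → ℂ} {C CΔ : ℝ} (hC : 0 ≤ C) (hCΔ : 0 ≤ CΔ)
    (hK : WeakNormLE (abkmNormParams L N Mord R p r₀ h θbar A (schedDelta δ₀ δ₁ N) 𝒞) k K C)
    (hK' : WeakNormLE (abkmNormParams L N Mord R p r₀ h θbar A (schedDelta δ₀ δ₁ N) 𝒞) k K' C)
    (hΔ : WeakNormLE (abkmNormParams L N Mord R p r₀ h θbar A (schedDelta δ₀ δ₁ N) 𝒞) k (K - K') CΔ)
    (hKd : ∀ Y, ContDiff ℝ r₀ (K Y)) (hK'd : ∀ Y, ContDiff ℝ r₀ (K' Y))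
    (hKloc : ∀ Y, IsPolymer (L ^ k) Y → IsConn Y → IsGaugeLocal ((abkmNormParams L N Mord R p r₀ h θbar A (schedDelta δ₀ δ₁ N) 𝒞).gauge k Y) (K Y))
    (hK'loc : ∀ Y, IsPolymer (L ^ k) Y → IsConn Y → IsGaugeLocal ((abkmNormParams L N Mord R p r₀ h θbar A (schedDelta δ₀ δ₁ N) 𝒞).gauge k Y) (K' Y))
    (hv : pi2BoundConst d (((2 * R + 2 : ℕ) : ℝ) + ((d / 2 + 1 : ℕ) : ℝ)) * (C * A𝒫' * A⁻¹) ≤ 1 / 64)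
    {κ : ℝ}
    (hκ1 : 1 + Real.exp (1 / 4) + 16 * Real.exp (3 / 8) * (2 * hamNorm (fieldWt h (L : ℝ) d k) ((L : ℝ) ^ k) (L ^ (d * k)) (H - H') + pi2BoundConst d (((2 * R + 2 : ℕ) : ℝ) + ((d / 2 + 1 : ℕ) : ℝ)) * (CΔ * A𝒫' * A⁻¹)) ≤ κ)
    (hκ2 : 1 + Real.exp (1 / 4) + 16 * Real.exp (3 / 8) * (2 * b + pi2BoundConst d (((2 * R + 2 : ℕ) : ℝ) + ((d / 2 + 1 : ℕ) : ℝ)) * (C * A𝒫' * A⁻¹)) ≤ κ) :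
    TayNormLE ((abkmNormParams L N Mord R p r₀ h θbar A (schedDelta δ₀ δ₁ N) 𝒞).gauge (k + 1) U) r₀ ((abkmWeightData L N Mord R θbar (schedDelta δ₀ δ₁ N) 𝒞).weight (k + 1) U)
      (fun φ => (∑ B ∈ blockPartIndex D U,
        ((bprod (L ^ k) (fun B' => expNegH (nextH D H K) B' φ) (U \ B) *
              bprod (L ^ k) (fun B' => expNegH (-(nextH D H K)) B' φ) (B \ U) - 1) * blockTerm D K B φ +
          bprod (L ^ k) (fun B' => expNegH (nextH D H K) B' φ) (U \ B) *
              bprod (L ^ k) (fun B' => expNegH (-(nextH D H K)) B' φ) (B \ U) *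
            (fluctDefect D.𝒞 H B φ +
              (expNegH (stepOpA (gradCov D.𝒞) H) B φ - 1) * (1 - Complex.exp (-(eval (opB D K) B φ))) -
              (Complex.exp (-(eval (opB D K) B φ)) - 1 + eval (opB D K) B φ)) +
          bprod (L ^ k) (fun B' => expNegH (nextH D H K) B' φ) (U \ B) *
              bprod (L ^ k) (fun B' => expNegH (-(nextH D H K)) B' φ) (B \ U) *
            fluct D.𝒞 (fun ψ => ∑ Y ∈ ((polys (L ^ k) B).erase B).erase ∅,
              bprod (L ^ k) (fun B' => expNegH H B' ψ - 1) (B \ Y) * K Y ψ) φ)) -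
        (∑ B ∈ blockPartIndex D U,
        ((bprod (L ^ k) (fun B' => expNegH (nextH D H' K') B' φ) (U \ B) *
              bprod (L ^ k) (fun B' => expNegH (-(nextH D H' K')) B' φ) (B \ U) - 1) * blockTerm D K' B φ +
          bprod (L ^ k) (fun B' => expNegH (nextH D H' K') B' φ) (U \ B) *
              bprod (L ^ k) (fun B' => expNegH (-(nextH D H' K')) B' φ) (B \ U) *
            (fluctDefect D.𝒞 H' B φ +
              (expNegH (stepOpA (gradCov D.𝒞) H') B φ - 1) * (1 - Complex.exp (-(eval (opB D K') B φ))) -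
              (Complex.exp (-(eval (opB D K') B φ)) - 1 + eval (opB D K') B φ)) +
          bprod (L ^ k) (fun B' => expNegH (nextH D H' K') B' φ) (U \ B) *
              bprod (L ^ k) (fun B' => expNegH (-(nextH D H' K')) B' φ) (B \ U) *
            fluct D.𝒞 (fun ψ => ∑ Y ∈ ((polys (L ^ k) B).erase B).erase ∅,
              bprod (L ^ k) (fun B' => expNegH H' B' ψ - 1) (B \ Y) * K' Y ψ) φ)))
      (((blocks (L ^ k) U).card : ℝ) * κ ^ (blocks (L ^ k) U).card * ((16 * Real.exp (3 / 8) * (2 * hamNorm (fieldWt h (L : ℝ) d k) ((L : ℝ) ^ k) (L ^ (d * k)) (H - H') + pi2BoundConst d (((2 * R + 2 : ℕ) : ℝ) + ((d / 2 + 1 : ℕ) : ℝ)) * (CΔ * A𝒫' * A⁻¹))) * (((1 + 8 * pi2BoundConst d (((2 * R + 2 : ℕ) : ℝ) + ((d / 2 + 1 : ℕ) : ℝ))) * (C * A𝒫' * A⁻¹)) + 256 * Real.exp (1 / 4) * ((A𝒫' + 4) * b ^ 2 + 2 * b * (pi2BoundConst d (((2 * R + 2 : ℕ) : ℝ) + ((d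 / 2 + 1 : ℕ) : ℝ)) * (C * A𝒫' * A⁻¹)) + (pi2BoundConst d (((2 * R + 2 : ℕ) : ℝ) + ((d / 2 + 1 : ℕ) : ℝ)) * (C * A𝒫' * A⁻¹)) ^ 2)) + 16 * Real.exp (3 / 8) * (2 * b + pi2BoundConst d (((2 * R + 2 : ℕ) : ℝ) + ((d / 2 + 1 : ℕ) : ℝ)) * (C * A𝒫' * A⁻¹)) * ((1 + 8 * pi2BoundConst d (((2 * R + 2 : ℕ) : ℝ) + ((d / 2 + 1 : ℕ) : ℝ))) * (CΔ * A𝒫' * A⁻¹)) + (512 * Real.exp (1 / 4) * (A𝒫' + 4) * (b + b) * hamNorm (fieldWt h (L : ℝ) d k) ((L : ℝ) ^ k) (L ^ (d * k)) (H - H') + 512 * Real.exp (1 / 4) * (hamNorm (fieldWt h (L : ℝ) d k) ((L : ℝ) ^ k) (L ^ (d * k)) (H - H') * (pi2BoundConst d (((2 * R + 2 : ℕ) : ℝ) + ((d / 2 + 1 : ℕ) : ℝ)) * (C * A𝒫' * A⁻¹)) + b * (pi2BoundConst d (((2 * R + 2 : ℕ) : ℝ) + ((d / 2 + 1 : ℕ)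 : ℝ)) * (CΔ * A𝒫' * A⁻¹))) + 256 * Real.exp (1 / 4) * (pi2BoundConst d (((2 * R + 2 : ℕ) : ℝ) + ((d / 2 + 1 : ℕ) : ℝ)) * (C * A𝒫' * A⁻¹) + pi2BoundConst d (((2 * R + 2 : ℕ) : ℝ) + ((d / 2 + 1 : ℕ) : ℝ)) * (CΔ * A𝒫' * A⁻¹)) * (pi2BoundConst d (((2 * R + 2 : ℕ) : ℝ) + ((d / 2 + 1 : ℕ) : ℝ)) * (CΔ * A𝒫' * A⁻¹)))) * (A * (abkmNormParams L N Mord R p r₀ h θbar A (schedDelta δ₀ δ₁ N) 𝒞).aFactor (k + 1) U)) := by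
  set P := abkmNormParams L N Mord R p r₀ h θbar A (schedDelta δ₀ δ₁ N) 𝒞 with hP
  set W := abkmWeightData L N Mord R θbar (schedDelta δ₀ δ₁ N) 𝒞 with hW
  have hd2 : 2 ≤ d := by omega
  have hL0 : (0 : ℝ) < L := by exact_mod_cast hLodd.pos
  have hA0 : 0 < A := by linarith
  have hk1 : k + 1 ≤ N + 1 := by omega
  have h𝔥 : 0 < fieldWt h (L : ℝ) d k := fieldWt_pos hh hL0 d k
  have hRk : (0 : ℝ) < (L : ℝ) ^ k := by positivity
  have hnn : ∀ G : RelevantHamiltonian ℂ d, 0 ≤ hamNorm (fieldWt h (L : ℝ) d k) ((L : ℝ) ^ k) (L ^ (d * k)) G :=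
    fun G => hamNorm_nonneg h𝔥.le hRk.le _ _
  have hb0 : 0 ≤ b := (hnn H).trans hH
  have hC87_0 : 0 ≤ pi2BoundConst d (((2 * R + 2 : ℕ) : ℝ) + ((d / 2 + 1 : ℕ) : ℝ)) := pi2BoundConst_nonneg d (by positivity)
  have hAinv : 0 ≤ A⁻¹ := inv_nonneg.2 hA0.le
  have hv0 : 0 ≤ pi2BoundConst d (((2 * R + 2 : ℕ) : ℝ) + ((d / 2 + 1 : ℕ) : ℝ)) * (C * A𝒫' * A⁻¹) := by positivity
  have hvΔ0 : 0 ≤ pi2BoundConst d (((2 * R + 2 : ℕ) : ℝ) + ((d / 2 + 1 : ℕ) : ℝ)) * (CΔ * A𝒫' * A⁻¹) := by positivity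
  have hnHH0 := hnn (H - H')
  have he38 : 0 ≤ 16 * Real.exp (3 / 8) := by positivity
  have he14 : 0 ≤ 8 * Real.exp (1 / 4) := by positivity
  have hHt0 := hamNorm_nextH_abkm_le_of_stepKernelBounds hd2 hLodd hL hM hkN hp1 hpR hr₀2 hB hh hh2 hA1 D hS hB₀ hc₀ H
    hC hK hKd hKloc
  have hHt'0 := hamNorm_nextH_abkm_le_of_stepKernelBounds hd2 hLodd hL hM hkN hp1 hpR hr₀2 hB hh hh2 hA1 D hS hB₀ hc₀ H'
    hC hK' hK'd hK'loc
  have hΔle := hamNorm_nextH_sub_abkm_le_of_stepKernelBounds hd2 hLodd hL hM hkN hp1 hpR hr₀2 hB hh hh2 hA1 D hS hB₀ hc₀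
    H H' hC hC hCΔ hK hK' hΔ hKd hK'd hKloc hK'loc
  have hHt : hamNorm (fieldWt h (L : ℝ) d k) ((L : ℝ) ^ k) (L ^ (d * k)) (nextH D H K) ≤ (2 * b + pi2BoundConst d (((2 * R + 2 : ℕ) : ℝ) + ((d / 2 + 1 : ℕ) : ℝ)) * (C * A𝒫' * A⁻¹)) := by
    linarith [hHt0, hH]
  have hHt' : hamNorm (fieldWt h (L : ℝ) d k) ((L : ℝ) ^ k) (L ^ (d * k)) (nextH D H' K') ≤ (2 * b + pi2BoundConst d (((2 * R + 2 : ℕ) : ℝ) + ((d / 2 + 1 : ℕ) : ℝ)) * (C * A𝒫' * A⁻¹)) := by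
    linarith [hHt'0, hH']
  have hτ : (2 * b + pi2BoundConst d (((2 * R + 2 : ℕ) : ℝ) + ((d / 2 + 1 : ℕ) : ℝ)) * (C * A𝒫' * A⁻¹)) ≤ 1 / 16 := by linarith [hb, hv]
  have hτ0 : 0 ≤ (2 * b + pi2BoundConst d (((2 * R + 2 : ℕ) : ℝ) + ((d / 2 + 1 : ℕ) : ℝ)) * (C * A𝒫' * A⁻¹)) := by positivity
  have hΔt : 16 * Real.exp (3 / 8) * hamNorm (fieldWt h (L : ℝ) d k) ((L : ℝ) ^ k) (L ^ (d * k)) (nextH D H K - nextH D H' K') ≤ 16 * Real.exp (3 / 8) * (2 * hamNorm (fieldWt h (L : ℝ) d k) ((L : ℝ) ^ k) (L ^ (d * k)) (H - H') + pi2BoundConst d (((2 * R + 2 : ℕ) : ℝ) + ((d / 2 + 1 : ℕ) : ℝ)) * (CΔ * A𝒫' * A⁻¹)) :=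
    mul_le_mul_of_nonneg_left hΔle he38
  have hκ : 1 + Real.exp (1 / 4) + 16 * Real.exp (3 / 8) * hamNorm (fieldWt h (L : ℝ) d k) ((L : ℝ) ^ k) (L ^ (d * k)) (nextH D H K - nextH D H' K') ≤ κ := by
    linarith [hΔt, hκ1]
  have hκ0 : 0 ≤ κ := by
    have e1 : 0 ≤ 16 * Real.exp (3 / 8) * hamNorm (fieldWt h (L : ℝ) d k) ((L : ℝ) ^ k) (L ^ (d * k)) (nextH D H K - nextH D H' K') := mul_nonneg he38 (hnn _)
    linarith [hκ, Real.exp_pos (1 / 4)]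
  have hκm0 : 0 ≤ κ ^ (blocks (L ^ k) U).card := pow_nonneg hκ0 _
  have hDP0 : 0 ≤ 16 * Real.exp (3 / 8) * (2 * hamNorm (fieldWt h (L : ℝ) d k) ((L : ℝ) ^ k) (L ^ (d * k)) (H - H') + pi2BoundConst d (((2 * R + 2 : ℕ) : ℝ) + ((d / 2 + 1 : ℕ) : ℝ)) * (CΔ * A𝒫' * A⁻¹)) := by positivity
  have hMo : Odd M := by rw [hM]; exact hLodd.pow
  have hsodd : Odd (L ^ k) := hLodd.pow
  have hM00 : (0 : ℝ) ≤ ((blocks (L ^ k) U).card : ℝ) := Nat.cast_nonneg _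
  have hg1_0 : 0 ≤ ((1 + 8 * pi2BoundConst d (((2 * R + 2 : ℕ) : ℝ) + ((d / 2 + 1 : ℕ) : ℝ))) * (C * A𝒫' * A⁻¹)) := by positivity
  have hgΦ0 : 0 ≤ 256 * Real.exp (1 / 4) * ((A𝒫' + 4) * b ^ 2 + 2 * b * (pi2BoundConst d (((2 * R + 2 : ℕ) : ℝ) + ((d / 2 + 1 : ℕ) : ℝ)) * (C * A𝒫' * A⁻¹)) + (pi2BoundConst d (((2 * R + 2 : ℕ) : ℝ) + ((d / 2 + 1 : ℕ) : ℝ)) * (C * A𝒫' * A⁻¹)) ^ 2) := by positivity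
  have hg0 : 0 ≤ ((1 + 8 * pi2BoundConst d (((2 * R + 2 : ℕ) : ℝ) + ((d / 2 + 1 : ℕ) : ℝ))) * (C * A𝒫' * A⁻¹)) + 256 * Real.exp (1 / 4) * ((A𝒫' + 4) * b ^ 2 + 2 * b * (pi2BoundConst d (((2 * R + 2 : ℕ) : ℝ) + ((d / 2 + 1 : ℕ) : ℝ)) * (C * A𝒫' * A⁻¹)) + (pi2BoundConst d (((2 * R + 2 : ℕ) : ℝ) + ((d / 2 + 1 : ℕ) : ℝ)) * (C * A𝒫' * A⁻¹)) ^ 2) := add_nonneg hg1_0 hgΦ0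
  have hρ1_0 : 0 ≤ ((1 + 8 * pi2BoundConst d (((2 * R + 2 : ℕ) : ℝ) + ((d / 2 + 1 : ℕ) : ℝ))) * (CΔ * A𝒫' * A⁻¹)) := by positivity
  have hρΦ0 : 0 ≤ (512 * Real.exp (1 / 4) * (A𝒫' + 4) * (b + b) * hamNorm (fieldWt h (L : ℝ) d k) ((L : ℝ) ^ k) (L ^ (d * k)) (H - H') + 512 * Real.exp (1 / 4) * (hamNorm (fieldWt h (L : ℝ) d k) ((L : ℝ) ^ k) (L ^ (d * k)) (H - H') * (pi2BoundConst d (((2 * R + 2 : ℕ) : ℝ) + ((d / 2 + 1 : ℕ) : ℝ)) * (C * A𝒫' * A⁻¹)) + b * (pi2BoundConst d (((2 * R + 2 : ℕ) : ℝ) + ((d / 2 + 1 : ℕ) : ℝ)) * (CΔ * A𝒫' * A⁻¹))) + 256 * Real.exp (1 / 4) * (pi2BoundConst d (((2 * R + 2 : ℕ) : ℝ) + ((d / 2 + 1 : ℕ) : ℝ)) * (C * A𝒫' * A⁻¹) + pi2BoundConst d (((2 * R + 2 : ℕ) : ℝ) + ((d / 2 + 1 : ℕ) : ℝ)) * (CΔ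 * A𝒫' * A⁻¹)) * (pi2BoundConst d (((2 * R + 2 : ℕ) : ℝ) + ((d / 2 + 1 : ℕ) : ℝ)) * (CΔ * A𝒫' * A⁻¹))) := by positivity
  have h1 := tayNormLE_remainderOne_sub_abkm_of_stepKernelBounds (p := p) (r₀ := r₀) (A := A) hd hLodd hL hR2 hM hkN hp1 hpR hMord hr₀2 hB hδ₀ hδ₁ hh hh0 hh2 hA𝒫 hA1 D hDs hDL hS hB₀ hc₀ hU hHt hHt' hτ hH hH' hb hC hCΔ hK hK' hΔ hKd hK'd
    hKloc hK'loc hv hκ hκ2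
  have h1' : TayNormLE (P.gauge (k + 1) U) r₀ (W.weight (k + 1) U) _ (((blocks (L ^ k) U).card : ℝ) * κ ^ (blocks (L ^ k) U).card * ((16 * Real.exp (3 / 8) * (2 * hamNorm (fieldWt h (L : ℝ) d k) ((L : ℝ) ^ k) (L ^ (d * k)) (H - H') + pi2BoundConst d (((2 * R + 2 : ℕ) : ℝ) + ((d / 2 + 1 : ℕ) : ℝ)) * (CΔ * A𝒫' * A⁻¹))) * (((1 + 8 * pi2BoundConst d (((2 * R + 2 : ℕ) : ℝ) + ((d / 2 + 1 : ℕ) : ℝ))) * (C * A𝒫' * A⁻¹)) + 256 * Real.exp (1 / 4) * ((A𝒫' + 4) * b ^ 2 + 2 * b * (pi2BoundConst d (((2 * R + 2 : ℕ) : ℝ) + ((d / 2 + 1 : ℕ) : ℝ)) * (C * A𝒫' * A⁻¹)) + (pi2BoundConst d (((2 * R + 2 : ℕ) : ℝ) + ((d / 2 + 1 : ℕ) : ℝ)) * (C * A𝒫' * A⁻¹)) ^ 2)) + 16 * Real.exp (3 / 8) * (2 * b + pi2BoundConst d (((2 * R + 2 : ℕ) : ℝ) + ((d / 2 + 1 :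 ℕ) : ℝ)) * (C * A𝒫' * A⁻¹)) * ((1 + 8 * pi2BoundConst d (((2 * R + 2 : ℕ) : ℝ) + ((d / 2 + 1 : ℕ) : ℝ))) * (CΔ * A𝒫' * A⁻¹)) + (512 * Real.exp (1 / 4) * (A𝒫' + 4) * (b + b) * hamNorm (fieldWt h (L : ℝ) d k) ((L : ℝ) ^ k) (L ^ (d * k)) (H - H') + 512 * Real.exp (1 / 4) * (hamNorm (fieldWt h (L : ℝ) d k) ((L : ℝ) ^ k) (L ^ (d * k)) (H - H') * (pi2BoundConst d (((2 * R + 2 : ℕ) : ℝ) + ((d / 2 + 1 : ℕ) : ℝ)) * (C * A𝒫' * A⁻¹)) + b * (pi2BoundConst d (((2 * R + 2 : ℕ) : ℝ) + ((d / 2 + 1 : ℕ) : ℝ)) * (CΔ * A𝒫' * A⁻¹))) + 256 * Real.exp (1 / 4) * (pi2BoundConst d (((2 * R + 2 : ℕ) : ℝ) + ((d / 2 + 1 : ℕ) : ℝ)) * (C * A𝒫' * A⁻¹) + pi2BoundConst d (((2 * R + 2 : ℕ) : ℝ) + ((d / 2 + 1 : ℕ) : ℝ)) * (CΔ * A𝒫'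 * A⁻¹)) * (pi2BoundConst d (((2 * R + 2 : ℕ) : ℝ) + ((d / 2 + 1 : ℕ) : ℝ)) * (CΔ * A𝒫' * A⁻¹))))) :=
    h1.mono
    (by
      gcongr) (fun φ => (W.weight_pos (k + 1) U φ).le)
  have hS1_0 : 0 ≤ ((blocks (L ^ k) U).card : ℝ) * κ ^ (blocks (L ^ k) U).card * ((16 * Real.exp (3 / 8) * (2 * hamNorm (fieldWt h (L : ℝ) d k) ((L : ℝ) ^ k) (L ^ (d * k)) (H - H') + pi2BoundConst d (((2 * R + 2 : ℕ) : ℝ) + ((d / 2 + 1 : ℕ) : ℝ)) * (CΔ * A𝒫' * A⁻¹))) * (((1 + 8 * pi2BoundConst d (((2 * R + 2 : ℕ) : ℝ) + ((d / 2 + 1 : ℕ) : ℝ))) * (C * A𝒫' * A⁻¹)) + 256 * Real.exp (1 / 4) * ((A𝒫' + 4) * b ^ 2 + 2 * b * (pi2BoundConst d (((2 * R + 2 : ℕ) : ℝ) + ((d / 2 + 1 : ℕ) : ℝ)) * (C * A𝒫' * A⁻¹)) + (pi2BoundConst d (((2 * R + 2 : ℕ) : ℝ) + ((d / 2 + 1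 : ℕ) : ℝ)) * (C * A𝒫' * A⁻¹)) ^ 2)) + 16 * Real.exp (3 / 8) * (2 * b + pi2BoundConst d (((2 * R + 2 : ℕ) : ℝ) + ((d / 2 + 1 : ℕ) : ℝ)) * (C * A𝒫' * A⁻¹)) * ((1 + 8 * pi2BoundConst d (((2 * R + 2 : ℕ) : ℝ) + ((d / 2 + 1 : ℕ) : ℝ))) * (CΔ * A𝒫' * A⁻¹)) + (512 * Real.exp (1 / 4) * (A𝒫' + 4) * (b + b) * hamNorm (fieldWt h (L : ℝ) d k) ((L : ℝ) ^ k) (L ^ (d * k)) (H - H') + 512 * Real.exp (1 / 4) * (hamNorm (fieldWt h (L : ℝ) d k) ((L : ℝ) ^ k) (L ^ (d * k)) (H - H') * (pi2BoundConst d (((2 * R + 2 : ℕ) : ℝ) + ((d / 2 + 1 : ℕ) : ℝ)) * (C * A𝒫' * A⁻¹)) + b * (pi2BoundConst d (((2 * R + 2 : ℕ) : ℝ) + ((d / 2 + 1 : ℕ) : ℝ)) * (CΔ * A𝒫' * A⁻¹))) + 256 * Real.exp (1 / 4) * (pi2BoundConst d (((2 * R + 2 : ℕ) : ℝ) + ((d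 / 2 + 1 : ℕ) : ℝ)) * (C * A𝒫' * A⁻¹) + pi2BoundConst d (((2 * R + 2 : ℕ) : ℝ) + ((d / 2 + 1 : ℕ) : ℝ)) * (CΔ * A𝒫' * A⁻¹)) * (pi2BoundConst d (((2 * R + 2 : ℕ) : ℝ) + ((d / 2 + 1 : ℕ) : ℝ)) * (CΔ * A𝒫' * A⁻¹)))) :=
    mul_nonneg (mul_nonneg hM00 hκm0) (add_nonneg (add_nonneg (mul_nonneg hDP0 hg0)
      (mul_nonneg (mul_nonneg he38 hτ0) hρ1_0)) hρΦ0)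
  by_cases hne : (blockPartIndex D U).Nonempty
  · obtain ⟨B, hB'⟩ := hne
    have hcl := (mem_filter.1 hB').2
    have hBb := (mem_filter.1 hB').1
    rw [hDs] at hBb
    obtain ⟨x, -, rfl⟩ := mem_blocks.1 hBb
    rw [hDs, hDL, closure_blockOf_mul hsodd hLodd x] at hcl
    have hnb : numBlocks (P.L ^ (k + 1)) U = 1 := by
      show numBlocks (L ^ (k + 1)) U = 1
      rw [← card_blocks_eq_numBlocks, pow_succ', ← hcl, blocks_blockOf, card_singleton]
    have haF : A * P.aFactor (k + 1) U = 1 := by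
      show A * (A ^ numBlocks (P.L ^ (k + 1)) U)⁻¹ = 1
      rw [hnb, pow_one, mul_inv_cancel₀ hA0.ne']
    rw [haF, mul_one]
    exact h1'
  · rw [not_nonempty_iff_eq_empty] at hne
    intro φ
    have hF : (fun φ => (∑ B ∈ blockPartIndex D U,
        ((bprod (L ^ k) (fun B' => expNegH (nextH D H K) B' φ) (U \ B) *
              bprod (L ^ k) (fun B' => expNegH (-(nextH D H K)) B' φ) (B \ U) - 1) * blockTerm D K B φ +
          bprod (L ^ k) (fun B' => expNegH (nextH D H K) B' φ) (U \ B) *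
              bprod (L ^ k) (fun B' => expNegH (-(nextH D H K)) B' φ) (B \ U) *
            (fluctDefect D.𝒞 H B φ +
              (expNegH (stepOpA (gradCov D.𝒞) H) B φ - 1) * (1 - Complex.exp (-(eval (opB D K) B φ))) -
              (Complex.exp (-(eval (opB D K) B φ)) - 1 + eval (opB D K) B φ)) +
          bprod (L ^ k) (fun B' => expNegH (nextH D H K) B' φ) (U \ B) *
              bprod (L ^ k) (fun B' => expNegH (-(nextH D H K)) B' φ) (B \ U) *
            fluct D.𝒞 (fun ψ => ∑ Y ∈ ((polys (L ^ k) B).erase B).erase ∅,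
              bprod (L ^ k) (fun B' => expNegH H B' ψ - 1) (B \ Y) * K Y ψ) φ)) -
        (∑ B ∈ blockPartIndex D U,
        ((bprod (L ^ k) (fun B' => expNegH (nextH D H' K') B' φ) (U \ B) *
              bprod (L ^ k) (fun B' => expNegH (-(nextH D H' K')) B' φ) (B \ U) - 1) * blockTerm D K' B φ +
          bprod (L ^ k) (fun B' => expNegH (nextH D H' K') B' φ) (U \ B) *
              bprod (L ^ k) (fun B' => expNegH (-(nextH D H' K')) B' φ) (B \ U) *
            (fluctDefect D.𝒞 H' B φ +
              (expNegH (stepOpA (gradCov D.𝒞) H') B φ - 1) * (1 - Complex.exp (-(eval (opB D K') B φ))) -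
              (Complex.exp (-(eval (opB D K') B φ)) - 1 + eval (opB D K') B φ)) +
          bprod (L ^ k) (fun B' => expNegH (nextH D H' K') B' φ) (U \ B) *
              bprod (L ^ k) (fun B' => expNegH (-(nextH D H' K')) B' φ) (B \ U) *
            fluct D.𝒞 (fun ψ => ∑ Y ∈ ((polys (L ^ k) B).erase B).erase ∅,
              bprod (L ^ k) (fun B' => expNegH H' B' ψ - 1) (B \ Y) * K' Y ψ) φ))) = fun _ => (0 : ℂ) := by
      funext ψ; rw [hne, sum_empty, sum_empty, sub_zero]
    rw [hF, tayNorm_const, norm_zero]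
    exact mul_nonneg (mul_nonneg hS1_0 (mul_nonneg hA0.le (WeakNormLE.aFactor_pos hA0 (k + 1) U).le))
      (W.weight_pos (k + 1) U φ).le

end Literature.MathematicalPhysics.StatisticalMechanics.GradientRG

end
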